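import Summits.BirchSwinnertonDyer.BirchSwinnertonDyer.Theses.SignedLowerHalves
import Summits.BirchSwinnertonDyer.BirchSwinnertonDyer.Theorems.SignedBaseChangeTwistPairGreenbergProductDivisibilitySplitAcanchorGlue
import Summits.BirchSwinnertonDyer.BirchSwinnertonDyer.Theorems.SignedBaseChangeK2RAssembly
import HarnessLib

/-!
# Line «defanchor» — COMPLETE kernel-typed line file (UNREGISTERED) for crux
# `KobayashiLowerHalfSemistable` (stmt-BirchSwinnertonDyer-19000), crux idea `definite-line-unit-lift` (G4–G8)

Ideator bsd-idea-13 g3 (planner-bsd-idea-13-g3-0, 2026-08-28). NOTHING about any curve is asserted, NO summit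
statement is proved, and NO line is registered by this seat (W-71 / W-79 / pen D34-1 (d): the skeleton of record of
stmt-19000 is `Lines/birth_musplit.lean`, registered by the LEAD; registering «defanchor» is a LEAD/pen decision —
ASK on the director bus 2026-08-28T07:47:18Z, default = not registered). If adopted, the LEAD copies this file to
`Lines/defanchor.lean`, turns the `def Sᵢ : Prop` below (S1, S2, S3, S4, S6, S7 — S5 is PROVED in §7, rev 2) into
`theorem stub_… : Sᵢ := by sorry` and keeps the composition (PROVED here against the `def`s), so the registered
skeleton's `KobayashiLowerHalfSemistable_of` is `kobayashiLowerHalfSemistable_of_defanchor₆ stub_S1 stub_S2 stub_S3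
stub_S4 stub_S6 stub_S7` (six stubs; or the seven-stub form `kobayashiLowerHalfSemistable_of_defanchor` of rev 1).
REV 2 (2026-08-28T08:59Z): §7 added — `definiteDescent : DefiniteDescent` (S5) PROVED from landed tree theorems (the
two-factor K2R⁗), and `kobayashiLowerHalfSemistable_of_defanchor₆` (six hypotheses); nothing else changed.
REV 3 (2026-08-28T09:07Z): §8 added — S3 WEAKENED to S3′ `ES2DefiniteIncl` (the bare inclusion `(G) ⊆ ch(X_Gr₂)^ur`, the
literal definite twin of stmt-20728): its `G ≠ 0` conjunct is DERIVED from S2 (`es2Definite_of_incl`: (P1) + `ch ≠ ⊥` +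
`𝓛^∘ ≠ 0`), and `kobayashiLowerHalfSemistable_of_defanchor₆' : S1 → S2 → S3′ → S4 → S6 → S7 → crux` is PROVED — THE FORM
TO REGISTER (six stubs over `DefiniteFieldSupply`, `DefinitePackage`, `ES2DefiniteIncl`, `DefiniteLineEisenstein`,
`NamedInputs`, `ThreeResidual`). Costume probes: `Sᵢ → crux` by `exact? | aesop | simpa` FAIL for all stubs incl. S3′.
REV 4 (2026-08-28T09:18Z): §9 added — answering idea-crit-14 VERDICT #21 (P1): S1 SPLIT into S1a `RamifiedLevelPrime` (the
one PUB input hidden in S1: some `q₀ ∣ N_W` with `p ∤ v_{q₀}(Δ_W) ∨ q₀² ≢ 1 (p)` — Ribet 1990 Thm 1.1 / Serre–Khare–Wintenberger,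
not yet a Literature fact in the tree) and S1b `DefiniteFieldSupplyFrom` (given such `q₀`: the field/tower supply, elementary);
`definiteFieldSupply_of : S1a → S1b → S1` and `kobayashiLowerHalfSemistable_of_defanchor₇ : S1a → S1b → S2 → S3′ → S4 → S6 →
S7 → crux` PROVED (seven stubs, the PUB input visible; `…₆'` remains the six-stub form). (P2) of the verdict is moot (S5
PROVED); (P3) conversion keeps every statement verbatim; (P4) first S4 falsifier test pair named in the line card.
REV 5 (2026-08-28T09:39Z; rev-2/3/4 stamps above corrected to commit times): §10 added — VARIANT «defmu»: the wall S4 AND the ES stub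
S3′ are REPLACED by (i) GMC_r BY NAME (BSTW Thm 9.24, the tree's OPEN binder `thm924_greenberg_dvd_charIdealXGr₂_awayFromCyc_OPEN`,
whose (spl) hypothesis the definite datum meets: `q₀` inert; «`2` split or `2 ∣ N`» added to the datum; `N` square-free from
X6 semistability), (ii) the anticyclotomic `μ(𝓛^∘(0,T₂)) = 0` put INSIDE the package existential (Cμ `DefinitePackageMu`;
Vatsal 2003 / Pollack–Weston 2011 Thm 2.5 + (1) at a definite-CR `K`, ramified branch `p ∤ v_{q₀}(Δ_W)` only — the CR
disjunct of revs 1–4 is narrowed accordingly in S1aʳ/S1bʳ/Cμ), (iii) the tree's kernel-proved cancellation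
`dvd_of_dvd_map_C_mul_of_hasUnitContent_minus`: `𝓛^∘ ∣ s(T₁)·ξ_∘` with `s ≠ 0` cyclotomic and `μ(𝓛^∘(0,T₂)) = 0` ⇒
`𝓛^∘ ∣ ξ_∘` two-variably (`dvd_of_awayFromCyc_of_package`, PROVED), then `definiteDescentDvd` (S5 from `∣`, PROVED).
`kobayashiLowerHalfSemistable_of_defmu : RamifiedLevelPrimeR → DefiniteFieldSupplyFromR → DefinitePackageMu → NamedInputs₂ →
ThreeResidual → crux` PROVED (five hypotheses; `lean check` rc 0, 0 sorries); probes `X → crux` FAIL for all four new stubs,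
`crux → Cμ` FAILS, Cμ / S1aʳ not provable outright (dlprobe5). Revs 1–4 («defanchor», S1–S7) are kept verbatim below.

THE LINE (p ≥ 5 branch = the definite-line anchor; p = 3 branch = the residual of line `birth_musplit` BY NAME):
* S1 `DefiniteFieldSupply` — for `(W, p)` on X6 at `5 ≤ p` and `N = N_W`: an imaginary quadratic `K` with `p` split,
  ONE prime `q₀ ∥ N` inert and every other `ℓ ∣ N` split (so `(N, D_K) = 1`, `N⁻ = q₀`: DEFINITE), the strong-CR
  disjunct at `q₀` (`p ∤ v_{q₀}(Δ_W)` or `q₀² ≢ 1 (mod p)`; such a `q₀` exists on X6 at `p ≥ 5` by Ribet's level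
  lowering, `S₂(SL₂(ℤ)) = 0`), `ρ̄_{E,p}|_{G_K}` absolutely irreducible (from `ClassX6.surj`), the `ℤ_p²`-tower data
  `(κ₁ cyc, κ₂ acyc, γ₁, γ₂)` with `γ₁` CANONICAL (`χ_K(γ₁)·ζ = 1 + p`), an embedding `ι` inducing `v ∣ p`.
  [Dirichlet + CRT + quadratic reciprocity; Ribet 1990 Thm 1.1; Serre 1972] — M/L-sized, no open input.
* S2 `DefinitePackage` (verbatim from `DefanchorSketch.lean` e0e1715f0fcc) — BSTW signed two-variable package for the
  definite-CR datum WITH `minus 𝓛^∘ ≠ 0` (Cornut–Vatsal non-triviality of definite theta elements). PRE-grade + PUB.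
* S3 `ES2Definite` (verbatim) — `G ≠ 0 ∧ (G) ⊆ ch(X_Gr₂)^ur` (definite twin of stmt-20728; `G ≠ 0` support-sized by the
  off-diagonal interpolation values `m − n ≥ 2`, card G4⁺(a) erratum rev 8f0373144aee).
* S4 `DefiniteLineEisenstein` (verbatim) — THE WALL: `minus 𝓛^∘ ∣ minus ξ_∘` on the definite anticyclotomic line for every
  package solution. Accepted critic constraint (ACK 08:03:58Z), carried here verbatim: «given S3 and `minus ξ_∘ ≠ 0`,
  S4 ⟺ the full two-variable signed equality»; designated first reshape by its prover: S4a (Howard-criterion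
  inclusion on the definite line, the R0/ATOM_∞ schema as a NAMED hypothesis; Howard 2006 Thm 3.2.3(c), in print only
  via GU(3,1) [corpus:paper:arxiv-2310.06813 p.20]) / S4b (no pseudo-null contribution of X_∘ on T₁ = 0; Lei–Palvannan
  arXiv:1806.07214, B.D. Kim CJM 2014, Lei–Sujatha) — not typed separately today: S4b needs a one-variable definite
  signed Selmer object the tree does not have (definition request on the card).
* S5 `DefiniteDescent` — 2-factor K2R⁗: from `ξ_∘ ~ 𝓛^∘` two-variably + (P1)–(P3) of the package + canonical `γ₁`,
  restrict to the CYCLOTOMIC line (`plus`), descend `𝒪_{ℂ_p}⟦T⟧ → Λ` (`SignedBaseChangeK2RDivisibilityDescent.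
  iwasawaAlgebra_dvd_of_map_dvd_map_padicComplexInt`), get `L^ε(f)·L^ε(f^{D_K}) ∣ g₁·g₂`, and squeeze with Kato
  (`thm41`, integral under `ClassX6.surj`) + Rohrlich (`kobayashiL_ne_zero`) + torsion (`thm12`) + the period unit
  (`realPeriodRat_eq_unit_mul_plusPeriod`) to Kobayashi's main conjecture for `W` — the 2-factor analogue of
  `SignedBaseChangeK2RTransferDescent.productLowerDivisibility_of_package` ∘ `SignedBaseChangeEisensteinSqueeze.X7.
  kobayashiMainConjecture_of_productLowerDivisibility` (both PROVED in the tree for 4 factors on X7). PROVED in §7 (rev 2).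
* S6 `NamedInputs` — BY NAME, HELD/cite-only: BSTW Thm 6.17 frame existence PRE
  (`thm617_exists_isGreenbergLFunctionAnyRoot₂_supersingular_PRE`) ∧ Kobayashi 2003 Thm 1.2 / Thm 4.1 (`thm12`, `thm41`,
  PUB) ∧ modularity with integral Manin constant (`nonempty_modularParametrizationData`, PUB) ∧ the period unit
  (`realPeriodRat_eq_unit_mul_plusPeriod`, PUB; = conjunct of `birth_musplit.stub_periodFacts`).
* S7 `ThreeResidual` — the `p = 3` (`a₃ = 0`) branch, = `BirthMuSplit.three` of the skeleton of record
  (`stub_three_rational ∧ stub_three_mu ∘ MuSplit`), BY NAME; this line adds nothing at `p = 3`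
  (NoAdmissiblePrimesAtThree bites every definite/bipartite input there).
COMPOSITION (PROVED, no sorry): `defAnchor_of : S2 → S3 → S4 → DefAnchor` (§4, from the sketch),
`kobayashiLowerHalfSemistable_of_defanchor₆ : S1 → S2 → S3 → S4 → S6 → S7 → KobayashiLowerHalfSemistable` (§7, rev 2) and
`kobayashiLowerHalfSemistable_of_defanchor : S1 → S2 → S3 → S4 → S5 → S6 → S7 → KobayashiLowerHalfSemistable` (§6:
`5 ≤ p`: modularity datum `π` ↦ newform `π.f` at level `N_W`; S1 ↦ field datum; S6.1 ↦ Katz/Greenberg frame;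
`exists_structureMap_padicInt` ↦ `J`; `defAnchor_of` ↦ associated package pair; S5 ↦ `KobayashiMainConjecture W p 1`
↦ `kobayashiLowerDivisibility_of_mainConjecture`; `p = 3`: S7; `p = 2, 4` excluded by `p ≠ 2` / primality).
Guardrail G1 honoured: no stub's ∃ pins the pair (ξ_∘, 𝓛^∘) by line restrictions only (S2 ∃ + S4 ∀-form + S3 ES2 +
`minus 𝓛^∘ ≠ 0` ⇒ `Associated`, `associated_of_signedLineAnchor`). Census (card G7): serves ≤ 7 open X6∧r0 cells at
p ≥ 5, 7/7 definite-CR-admissible; class-wide at 5 ≤ p; 0 at p = 3; 0 on r = 1.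
-/

-- D-0017: single-problem summit, the namespace repeats the problem name by design.
set_option linter.dupNamespace false
set_option autoImplicit false

noncomputable section

open scoped Classical

open NumberField IsDedekindDomain Field CongruenceSubgroup
open Literature.NumberTheory.GaloisRepresentations
open Literature.NumberTheory.EllipticCurves Literature.NumberTheory.EllipticCurves.BurungaleSkinnerTianWan2024
open Literature.NumberTheory.EllipticCurves.ModularForms

namespace Summit.BirchSwinnertonDyer.BirchSwinnertonDyer.Cruxes.KobayashiLowerHalfSemistable.DefanchorLine

open Summit.BirchSwinnertonDyer.BirchSwinnertonDyer.Theorems.SignedBaseChangeK1Acanchor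

/-! ### §0 The signed-currency anchor lift (VERBATIM copy of `DefiniteLineUnitLiftGuardrail.associated_of_signedLineAnchor`,
crux workfile bfdfddda0d0c — inlined so that this line file does not depend on the build state of a `Cruxes/` module) -/

section SignedAnchor

variable {A : Type*} [CommRing A] [IsDomain A]

/-- **Signed-currency anchor lift.** In `A⟦T₁⟧` over a domain `A` (think `A = 𝒪⟦T₂⟧`, line `T₁ = 0` =
`constantCoeff`): if `I` is principal, `(ξ·G) = I·(L)` (P1), `(G) ⊆ I` (two-variable Euler system),
`G ≠ 0`, `L(0) ≠ 0` and `L(0) ∣ ξ(0)` (Eisenstein divisibility ON THE LINE for the signed pair), then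
`ξ ~ L`. Proof: `I = (c)`, `G = c·h`, `ξ·c·h ~ c·L` gives `L = ξ·h·u`; on the line `L₀ = ξ₀h₀u₀` and
`ξ₀ = L₀m` force `m·h₀·u₀ = 1`, so `h` is a unit (`PowerSeries.isUnit_iff_constantCoeff`). -/
theorem associated_of_signedLineAnchor {I : Ideal (PowerSeries A)} (hI : I.IsPrincipal)
    {ξ L G : PowerSeries A}
    (hP1 : Ideal.span {ξ * G} = I * Ideal.span {L})
    (hES : Ideal.span {G} ≤ I) (hG : G ≠ 0)
    (hne : PowerSeries.constantCoeff L ≠ 0)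
    (hanch : PowerSeries.constantCoeff L ∣ PowerSeries.constantCoeff ξ) :
    Associated ξ L := by
  obtain ⟨⟨c, hc⟩⟩ := hI
  have hc' : I = Ideal.span {c} := hc
  subst hc'
  -- `G = c * h`
  obtain ⟨h, rfl⟩ : c ∣ G :=
    Ideal.mem_span_singleton.mp (hES (Ideal.mem_span_singleton_self G))
  have hc0 : c ≠ 0 := left_ne_zero_of_mul hG
  -- (P1) as an association `ξ * (c * h) ~ c * L`
  have hP1' : Ideal.span {ξ * (c * h)} = Ideal.span {c * L} := by
    rw [hP1, Ideal.span_singleton_mul_span_singleton]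
  obtain ⟨u, hu⟩ := (Ideal.span_singleton_eq_span_singleton.mp hP1')
  -- cancel `c`: `L = ξ * h * u`
  have hL : L = ξ * (h * u) := by
    apply mul_left_cancel₀ hc0
    calc c * L = ξ * (c * h) * u := hu.symm
      _ = c * (ξ * (h * u)) := by ring
  -- on the line: `h(0)` is a unit
  have h0 : PowerSeries.constantCoeff L =
      PowerSeries.constantCoeff ξ * (PowerSeries.constantCoeff h * PowerSeries.constantCoeff (u : PowerSeries A)) := by
    conv_lhs => rw [hL]
    simp [map_mul]
  obtain ⟨m, hm⟩ := hanch
  have h1 : PowerSeries.constantCoeff h *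
      (PowerSeries.constantCoeff (u : PowerSeries A) * m) = 1 := by
    apply mul_left_cancel₀ hne
    calc PowerSeries.constantCoeff L *
          (PowerSeries.constantCoeff h * (PowerSeries.constantCoeff (u : PowerSeries A) * m))
          = (PowerSeries.constantCoeff L * m) *
            (PowerSeries.constantCoeff h * PowerSeries.constantCoeff (u : PowerSeries A)) := by ring
      _ = PowerSeries.constantCoeff ξ *
            (PowerSeries.constantCoeff h * PowerSeries.constantCoeff (u : PowerSeries A)) := by rw [← hm]
      _ = PowerSeries.constantCoeff L := h0.symm
      _ = PowerSeries.constantCoeff L * 1 := (mul_one _).symm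
  have hhu : IsUnit h :=
    PowerSeries.isUnit_iff_constantCoeff.mpr (IsUnit.of_mul_eq_one _ h1)
  refine ⟨hhu.unit * u, ?_⟩
  rw [hL, Units.val_mul, IsUnit.unit_spec]

end SignedAnchor

/-- **S2 `stub_definitePackage` (designed, PRE-grade + Cornut–Vatsal non-vanishing):** for every definite-CR datum
the BSTW signed two-variable package exists WITH `𝓛^∘` non-zero on the anticyclotomic line `T₁ = 0`.
Text = the PRE package binder verbatim + definite clauses + the conjunct `minus Lsig ≠ 0`. Nothing asserted. -/
def DefinitePackage : Prop :=
  ∀ {p : ℕ} [Fact p.Prime] (ι : PadicAlgCl p ≃+* ℂ) (W : WeierstrassCurve ℚ) [W.IsElliptic]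
    [W.IsGloballyMinimal] (K : Type) [Field K] [NumberField K] (v vbar : HeightOneSpectrum (𝓞 K))
    (κ₁ κ₂ : ZpExtension K p) (γ₁ γ₂ : absoluteGaloisGroup K)
    [Fact (ZpExtension.IsTopGeneratorPair κ₁ κ₂ γ₁ γ₂)] {N : ℕ} [NeZero N] (f : CuspForm (Gamma0 N) 2)
    [NeZero (NumberField.discr K).natAbs],
    IsNewformOf W f → (N : ℤ) = W.conductorNorm ℤ → p ≠ 2 → ¬ (p : ℤ) ∣ W.conductorNorm ℤ →
    W.frobeniusTrace p = 0 →
    IsImaginaryQuadratic K → ((Ideal.span {(p : ℤ)}).primesOver (𝓞 K)).ncard = 2 →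
    ((p : ℕ) : 𝓞 K) ∈ v.asIdeal → ((p : ℕ) : 𝓞 K) ∈ vbar.asIdeal → vbar ≠ v →
    (∀ (w : InfinitePlace K) (k : 𝓞 K), k ∈ v.asIdeal ↔ ‖ι.symm (w.embedding (k : K))‖ < 1) →
    IsCoprime (N : ℤ) (NumberField.discr K) →
    -- ⟨definite-CR clauses (card G4 S1): X6 at 5 ≤ p; ONE prime q₀ ∥ N inert in K, every other ℓ ∣ N split;
    --  (CR) ρ̄ ramified at q₀ (p ∤ v_{q₀}(Δ_W), Tate) or q₀² ≢ 1 (mod p)⟩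
    5 ≤ p → Rank1Residual.ClassX6 W p →
    ∀ q₀ : ℕ, q₀.Prime → q₀ ∣ N → ¬ (q₀ ^ 2 ∣ N) →
      ((Ideal.span {(q₀ : ℤ)}).primesOver (𝓞 K)).ncard = 1 →
      (∀ ℓ : ℕ, ℓ.Prime → ℓ ∣ N → ℓ ≠ q₀ → ((Ideal.span {(ℓ : ℤ)}).primesOver (𝓞 K)).ncard = 2) →
      (¬ ((p : ℤ) ∣ padicValRat q₀ W.Δ) ∨ ¬ (q₀ ^ 2 ≡ 1 [MOD p])) →
    (∀ ρ : ModPGaloisRep K (ZMod p) 2, (W.baseChange K).IsTorsionGaloisRep p ρ →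
      FramedRep.IsAbsolutelyIrreducible ρ) →
    κ₁.IsCyclotomic → κ₂.IsAnticyclotomic →
    ∀ (Ω δ : ℂ) (Ωp : (unrIntegers p)ˣ) (LK G : PowerSeries (PowerSeries (PadicComplexInt p))),
      Ω ≠ 0 → (δ ^ 2 = (NumberField.discr K : ℂ) ∨ δ ^ 2 = -(NumberField.discr K : ℂ)) →
      IsKatzMeasure₂ ι v vbar ∅ κ₁ κ₂ γ₁⁻¹ γ₂⁻¹ 1 Ω δ ((Ωp : unrIntegers p) : PadicComplex p) LK →
      IsGreenbergLFunctionAnyRoot₂ ι v vbar κ₁ κ₂ γ₁⁻¹ γ₂⁻¹ f (NumberField.discr K).natAbs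
        (NumberField.classNumber K) LK G →
    ∀ J : ℤ_[p] →+* PadicComplexInt p,
      (∀ x : ℤ_[p], ((J x : PadicComplexInt p) : PadicComplex p) = ((x : ℚ_[p]) : PadicComplex p)) →
    ∀ ε : ℤˣ,
    ∃ xi Lsig : PowerSeries (PowerSeries (PadicComplexInt p)),
      UnrSeries₂.minus Lsig ≠ 0 ∧
      (Ideal.span {xi * G} =
          (WeierstrassCurve.XGr₂.charIdeal (W.baseChange K) p κ₁ κ₂ vbar γ₁ γ₂).map
              (IwasawaAlgebra₂.toUnr₂ p J) * Ideal.span {Lsig} ∧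
      ∀ (κ : ZpExtension ℚ p) (γ : absoluteGaloisGroup ℚ), κ.IsCyclotomic → κ.IsTopGenerator γ →
        IsCyclotomicVariable p γ →
        (∃ ζ : ℤ_[p]ˣ, IsOfFinOrder ζ ∧
          GaloisRep.cyclotomicCharacter ℚ p γ * ζ = GaloisRep.cyclotomicCharacter K p γ₁) →
        ∀ (W₂ : WeierstrassCurve ℚ) [W₂.IsElliptic] [W₂.IsGloballyMinimal]
          (C₂ : WeierstrassCurve.VariableChange ℚ),
          C₂ • W₂ = W.quadraticTwist (NumberField.discr K : ℚ) →
          (∀ (D₁ : Kobayashi2003.SignedSelmerDualData W κ γ ε)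
              (D₂ : Kobayashi2003.SignedSelmerDualData W₂ κ γ ε) (g₁ g₂ : IwasawaAlgebra p),
              D₁.charIdeal = Ideal.span {g₁} → D₂.charIdeal = Ideal.span {g₂} →
              UnrSeries₂.plus xi ∣ PowerSeries.map J (g₁ * g₂)) ∧
          (∀ {N₂ : ℕ} [NeZero N₂] (f₂ : CuspForm (Gamma0 N₂) 2), IsNewformOf W₂ f₂ →
            ∀ (L₁ L₂ : IwasawaAlgebra p), Kobayashi2003.IsSignedPAdicLFunction f p ε L₁ →
              Kobayashi2003.IsSignedPAdicLFunction f₂ p ε L₂ →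
              ∃ u : PowerSeries (PadicComplexInt p), IsUnit u ∧
                UnrSeries₂.plus Lsig = u * PowerSeries.map J (L₁ * L₂)))

/-- **S3 `stub_ES2definite` (designed; twin of stmt-20728 for a definite-CR `K`, with `G ≠ 0`):** the integral
two-variable Euler-system inclusion `(G) ⊆ ch(X_Gr₂(E/K_∞))^ur` and `G ≠ 0`. Nothing asserted. -/
def ES2Definite : Prop :=
  ∀ {p : ℕ} [Fact p.Prime] (ι : PadicAlgCl p ≃+* ℂ) (W : WeierstrassCurve ℚ) [W.IsElliptic]
    [W.IsGloballyMinimal] (K : Type) [Field K] [NumberField K] (v vbar : HeightOneSpectrum (𝓞 K))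
    (κ₁ κ₂ : ZpExtension K p) (γ₁ γ₂ : absoluteGaloisGroup K)
    [Fact (ZpExtension.IsTopGeneratorPair κ₁ κ₂ γ₁ γ₂)] {N : ℕ} [NeZero N] (f : CuspForm (Gamma0 N) 2)
    [NeZero (NumberField.discr K).natAbs],
    IsNewformOf W f → (N : ℤ) = W.conductorNorm ℤ → p ≠ 2 → ¬ (p : ℤ) ∣ W.conductorNorm ℤ →
    W.frobeniusTrace p = 0 →
    IsImaginaryQuadratic K → ((Ideal.span {(p : ℤ)}).primesOver (𝓞 K)).ncard = 2 →
    ((p : ℕ) : 𝓞 K) ∈ v.asIdeal → ((p : ℕ) : 𝓞 K) ∈ vbar.asIdeal → vbar ≠ v →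
    (∀ (w : InfinitePlace K) (k : 𝓞 K), k ∈ v.asIdeal ↔ ‖ι.symm (w.embedding (k : K))‖ < 1) →
    IsCoprime (N : ℤ) (NumberField.discr K) →
    -- ⟨definite-CR clauses (card G4 S1): X6 at 5 ≤ p; ONE prime q₀ ∥ N inert in K, every other ℓ ∣ N split;
    --  (CR) ρ̄ ramified at q₀ (p ∤ v_{q₀}(Δ_W), Tate) or q₀² ≢ 1 (mod p)⟩
    5 ≤ p → Rank1Residual.ClassX6 W p →
    ∀ q₀ : ℕ, q₀.Prime → q₀ ∣ N → ¬ (q₀ ^ 2 ∣ N) →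
      ((Ideal.span {(q₀ : ℤ)}).primesOver (𝓞 K)).ncard = 1 →
      (∀ ℓ : ℕ, ℓ.Prime → ℓ ∣ N → ℓ ≠ q₀ → ((Ideal.span {(ℓ : ℤ)}).primesOver (𝓞 K)).ncard = 2) →
      (¬ ((p : ℤ) ∣ padicValRat q₀ W.Δ) ∨ ¬ (q₀ ^ 2 ≡ 1 [MOD p])) →
    (∀ ρ : ModPGaloisRep K (ZMod p) 2, (W.baseChange K).IsTorsionGaloisRep p ρ →
      FramedRep.IsAbsolutelyIrreducible ρ) →
    κ₁.IsCyclotomic → κ₂.IsAnticyclotomic →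
    ∀ (Ω δ : ℂ) (Ωp : (unrIntegers p)ˣ) (LK G : PowerSeries (PowerSeries (PadicComplexInt p))),
      Ω ≠ 0 → (δ ^ 2 = (NumberField.discr K : ℂ) ∨ δ ^ 2 = -(NumberField.discr K : ℂ)) →
      IsKatzMeasure₂ ι v vbar ∅ κ₁ κ₂ γ₁⁻¹ γ₂⁻¹ 1 Ω δ ((Ωp : unrIntegers p) : PadicComplex p) LK →
      IsGreenbergLFunctionAnyRoot₂ ι v vbar κ₁ κ₂ γ₁⁻¹ γ₂⁻¹ f (NumberField.discr K).natAbs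
        (NumberField.classNumber K) LK G →
    ∀ J : ℤ_[p] →+* PadicComplexInt p,
      (∀ x : ℤ_[p], ((J x : PadicComplexInt p) : PadicComplex p) = ((x : ℚ_[p]) : PadicComplex p)) →
      G ≠ 0 ∧
      Ideal.span {G} ≤
        (WeierstrassCurve.XGr₂.charIdeal (W.baseChange K) p κ₁ κ₂ vbar γ₁ γ₂).map (IwasawaAlgebra₂.toUnr₂ p J)

/-- **S4 `stub_definiteLineEisenstein` (designed; the card's WALL — one-variable definite signed anticyclotomic
Eisenstein inclusion, ∀-form over ALL package solutions with `minus Lsig ≠ 0`):** `𝓛^∘⁻ ∣ ξ_∘⁻`. Nothing asserted. -/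
def DefiniteLineEisenstein : Prop :=
  ∀ {p : ℕ} [Fact p.Prime] (ι : PadicAlgCl p ≃+* ℂ) (W : WeierstrassCurve ℚ) [W.IsElliptic]
    [W.IsGloballyMinimal] (K : Type) [Field K] [NumberField K] (v vbar : HeightOneSpectrum (𝓞 K))
    (κ₁ κ₂ : ZpExtension K p) (γ₁ γ₂ : absoluteGaloisGroup K)
    [Fact (ZpExtension.IsTopGeneratorPair κ₁ κ₂ γ₁ γ₂)] {N : ℕ} [NeZero N] (f : CuspForm (Gamma0 N) 2)
    [NeZero (NumberField.discr K).natAbs],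
    IsNewformOf W f → (N : ℤ) = W.conductorNorm ℤ → p ≠ 2 → ¬ (p : ℤ) ∣ W.conductorNorm ℤ →
    W.frobeniusTrace p = 0 →
    IsImaginaryQuadratic K → ((Ideal.span {(p : ℤ)}).primesOver (𝓞 K)).ncard = 2 →
    ((p : ℕ) : 𝓞 K) ∈ v.asIdeal → ((p : ℕ) : 𝓞 K) ∈ vbar.asIdeal → vbar ≠ v →
    (∀ (w : InfinitePlace K) (k : 𝓞 K), k ∈ v.asIdeal ↔ ‖ι.symm (w.embedding (k : K))‖ < 1) →
    IsCoprime (N : ℤ) (NumberField.discr K) →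
    -- ⟨definite-CR clauses (card G4 S1): X6 at 5 ≤ p; ONE prime q₀ ∥ N inert in K, every other ℓ ∣ N split;
    --  (CR) ρ̄ ramified at q₀ (p ∤ v_{q₀}(Δ_W), Tate) or q₀² ≢ 1 (mod p)⟩
    5 ≤ p → Rank1Residual.ClassX6 W p →
    ∀ q₀ : ℕ, q₀.Prime → q₀ ∣ N → ¬ (q₀ ^ 2 ∣ N) →
      ((Ideal.span {(q₀ : ℤ)}).primesOver (𝓞 K)).ncard = 1 →
      (∀ ℓ : ℕ, ℓ.Prime → ℓ ∣ N → ℓ ≠ q₀ → ((Ideal.span {(ℓ : ℤ)}).primesOver (𝓞 K)).ncard = 2) →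
      (¬ ((p : ℤ) ∣ padicValRat q₀ W.Δ) ∨ ¬ (q₀ ^ 2 ≡ 1 [MOD p])) →
    (∀ ρ : ModPGaloisRep K (ZMod p) 2, (W.baseChange K).IsTorsionGaloisRep p ρ →
      FramedRep.IsAbsolutelyIrreducible ρ) →
    κ₁.IsCyclotomic → κ₂.IsAnticyclotomic →
    ∀ (Ω δ : ℂ) (Ωp : (unrIntegers p)ˣ) (LK G : PowerSeries (PowerSeries (PadicComplexInt p))),
      Ω ≠ 0 → (δ ^ 2 = (NumberField.discr K : ℂ) ∨ δ ^ 2 = -(NumberField.discr K : ℂ)) →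
      IsKatzMeasure₂ ι v vbar ∅ κ₁ κ₂ γ₁⁻¹ γ₂⁻¹ 1 Ω δ ((Ωp : unrIntegers p) : PadicComplex p) LK →
      IsGreenbergLFunctionAnyRoot₂ ι v vbar κ₁ κ₂ γ₁⁻¹ γ₂⁻¹ f (NumberField.discr K).natAbs
        (NumberField.classNumber K) LK G →
    ∀ J : ℤ_[p] →+* PadicComplexInt p,
      (∀ x : ℤ_[p], ((J x : PadicComplexInt p) : PadicComplex p) = ((x : ℚ_[p]) : PadicComplex p)) →
    ∀ ε : ℤˣ,
    ∀ xi Lsig : PowerSeries (PowerSeries (PadicComplexInt p)),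
      UnrSeries₂.minus Lsig ≠ 0 →
      (Ideal.span {xi * G} =
          (WeierstrassCurve.XGr₂.charIdeal (W.baseChange K) p κ₁ κ₂ vbar γ₁ γ₂).map
              (IwasawaAlgebra₂.toUnr₂ p J) * Ideal.span {Lsig} ∧
      ∀ (κ : ZpExtension ℚ p) (γ : absoluteGaloisGroup ℚ), κ.IsCyclotomic → κ.IsTopGenerator γ →
        IsCyclotomicVariable p γ →
        (∃ ζ : ℤ_[p]ˣ, IsOfFinOrder ζ ∧
          GaloisRep.cyclotomicCharacter ℚ p γ * ζ = GaloisRep.cyclotomicCharacter K p γ₁) →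
        ∀ (W₂ : WeierstrassCurve ℚ) [W₂.IsElliptic] [W₂.IsGloballyMinimal]
          (C₂ : WeierstrassCurve.VariableChange ℚ),
          C₂ • W₂ = W.quadraticTwist (NumberField.discr K : ℚ) →
          (∀ (D₁ : Kobayashi2003.SignedSelmerDualData W κ γ ε)
              (D₂ : Kobayashi2003.SignedSelmerDualData W₂ κ γ ε) (g₁ g₂ : IwasawaAlgebra p),
              D₁.charIdeal = Ideal.span {g₁} → D₂.charIdeal = Ideal.span {g₂} →
              UnrSeries₂.plus xi ∣ PowerSeries.map J (g₁ * g₂)) ∧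
          (∀ {N₂ : ℕ} [NeZero N₂] (f₂ : CuspForm (Gamma0 N₂) 2), IsNewformOf W₂ f₂ →
            ∀ (L₁ L₂ : IwasawaAlgebra p), Kobayashi2003.IsSignedPAdicLFunction f p ε L₁ →
              Kobayashi2003.IsSignedPAdicLFunction f₂ p ε L₂ →
              ∃ u : PowerSeries (PadicComplexInt p), IsUnit u ∧
                UnrSeries₂.plus Lsig = u * PowerSeries.map J (L₁ * L₂))) →
      UnrSeries₂.minus Lsig ∣ UnrSeries₂.minus xi

/-- **The definite anchor (conclusion of the composition):** for every definite-CR datum and sign, SOME package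
pair is ASSOCIATED two-variably, `ξ_∘ ~ 𝓛^∘` in `𝒪_{ℂ_p}⟦T₁⟧⟦T₂⟧` (input of the designed sandwich stub S5). -/
def DefAnchor : Prop :=
  ∀ {p : ℕ} [Fact p.Prime] (ι : PadicAlgCl p ≃+* ℂ) (W : WeierstrassCurve ℚ) [W.IsElliptic]
    [W.IsGloballyMinimal] (K : Type) [Field K] [NumberField K] (v vbar : HeightOneSpectrum (𝓞 K))
    (κ₁ κ₂ : ZpExtension K p) (γ₁ γ₂ : absoluteGaloisGroup K)
    [Fact (ZpExtension.IsTopGeneratorPair κ₁ κ₂ γ₁ γ₂)] {N : ℕ} [NeZero N] (f : CuspForm (Gamma0 N) 2)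
    [NeZero (NumberField.discr K).natAbs],
    IsNewformOf W f → (N : ℤ) = W.conductorNorm ℤ → p ≠ 2 → ¬ (p : ℤ) ∣ W.conductorNorm ℤ →
    W.frobeniusTrace p = 0 →
    IsImaginaryQuadratic K → ((Ideal.span {(p : ℤ)}).primesOver (𝓞 K)).ncard = 2 →
    ((p : ℕ) : 𝓞 K) ∈ v.asIdeal → ((p : ℕ) : 𝓞 K) ∈ vbar.asIdeal → vbar ≠ v →
    (∀ (w : InfinitePlace K) (k : 𝓞 K), k ∈ v.asIdeal ↔ ‖ι.symm (w.embedding (k : K))‖ < 1) →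
    IsCoprime (N : ℤ) (NumberField.discr K) →
    -- ⟨definite-CR clauses (card G4 S1): X6 at 5 ≤ p; ONE prime q₀ ∥ N inert in K, every other ℓ ∣ N split;
    --  (CR) ρ̄ ramified at q₀ (p ∤ v_{q₀}(Δ_W), Tate) or q₀² ≢ 1 (mod p)⟩
    5 ≤ p → Rank1Residual.ClassX6 W p →
    ∀ q₀ : ℕ, q₀.Prime → q₀ ∣ N → ¬ (q₀ ^ 2 ∣ N) →
      ((Ideal.span {(q₀ : ℤ)}).primesOver (𝓞 K)).ncard = 1 →
      (∀ ℓ : ℕ, ℓ.Prime → ℓ ∣ N → ℓ ≠ q₀ → ((Ideal.span {(ℓ : ℤ)}).primesOver (𝓞 K)).ncard = 2) →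
      (¬ ((p : ℤ) ∣ padicValRat q₀ W.Δ) ∨ ¬ (q₀ ^ 2 ≡ 1 [MOD p])) →
    (∀ ρ : ModPGaloisRep K (ZMod p) 2, (W.baseChange K).IsTorsionGaloisRep p ρ →
      FramedRep.IsAbsolutelyIrreducible ρ) →
    κ₁.IsCyclotomic → κ₂.IsAnticyclotomic →
    ∀ (Ω δ : ℂ) (Ωp : (unrIntegers p)ˣ) (LK G : PowerSeries (PowerSeries (PadicComplexInt p))),
      Ω ≠ 0 → (δ ^ 2 = (NumberField.discr K : ℂ) ∨ δ ^ 2 = -(NumberField.discr K : ℂ)) →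
      IsKatzMeasure₂ ι v vbar ∅ κ₁ κ₂ γ₁⁻¹ γ₂⁻¹ 1 Ω δ ((Ωp : unrIntegers p) : PadicComplex p) LK →
      IsGreenbergLFunctionAnyRoot₂ ι v vbar κ₁ κ₂ γ₁⁻¹ γ₂⁻¹ f (NumberField.discr K).natAbs
        (NumberField.classNumber K) LK G →
    ∀ J : ℤ_[p] →+* PadicComplexInt p,
      (∀ x : ℤ_[p], ((J x : PadicComplexInt p) : PadicComplex p) = ((x : ℚ_[p]) : PadicComplex p)) →
    ∀ ε : ℤˣ,
    ∃ xi Lsig : PowerSeries (PowerSeries (PadicComplexInt p)),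
      Associated xi Lsig ∧
      (Ideal.span {xi * G} =
          (WeierstrassCurve.XGr₂.charIdeal (W.baseChange K) p κ₁ κ₂ vbar γ₁ γ₂).map
              (IwasawaAlgebra₂.toUnr₂ p J) * Ideal.span {Lsig} ∧
      ∀ (κ : ZpExtension ℚ p) (γ : absoluteGaloisGroup ℚ), κ.IsCyclotomic → κ.IsTopGenerator γ →
        IsCyclotomicVariable p γ →
        (∃ ζ : ℤ_[p]ˣ, IsOfFinOrder ζ ∧
          GaloisRep.cyclotomicCharacter ℚ p γ * ζ = GaloisRep.cyclotomicCharacter K p γ₁) →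
        ∀ (W₂ : WeierstrassCurve ℚ) [W₂.IsElliptic] [W₂.IsGloballyMinimal]
          (C₂ : WeierstrassCurve.VariableChange ℚ),
          C₂ • W₂ = W.quadraticTwist (NumberField.discr K : ℚ) →
          (∀ (D₁ : Kobayashi2003.SignedSelmerDualData W κ γ ε)
              (D₂ : Kobayashi2003.SignedSelmerDualData W₂ κ γ ε) (g₁ g₂ : IwasawaAlgebra p),
              D₁.charIdeal = Ideal.span {g₁} → D₂.charIdeal = Ideal.span {g₂} →
              UnrSeries₂.plus xi ∣ PowerSeries.map J (g₁ * g₂)) ∧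
          (∀ {N₂ : ℕ} [NeZero N₂] (f₂ : CuspForm (Gamma0 N₂) 2), IsNewformOf W₂ f₂ →
            ∀ (L₁ L₂ : IwasawaAlgebra p), Kobayashi2003.IsSignedPAdicLFunction f p ε L₁ →
              Kobayashi2003.IsSignedPAdicLFunction f₂ p ε L₂ →
              ∃ u : PowerSeries (PadicComplexInt p), IsUnit u ∧
                UnrSeries₂.plus Lsig = u * PowerSeries.map J (L₁ * L₂)))

/-- **Anchor composition, PROVED:** S2 ∧ S3 ∧ S4 ⟹ the definite anchor, by `charIdealIsPrincipal₂` (two-variable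
characteristic ideals are principal) and the guardrail's `associated_of_signedLineAnchor` (which never restricts
`G` or the generator of the characteristic ideal to the line, so it survives `minus G = 0`). -/
theorem defAnchor_of (h2 : DefinitePackage) (h3 : ES2Definite) (h4 : DefiniteLineEisenstein) : DefAnchor := by
  intro p _ ι W _ _ K _ _ v vbar κ₁ κ₂ γ₁ γ₂ _ N _ f _ hf hN hp2 hpN ha0 hIQ hsp hv hvbar hvv hι hcop h5 hX6 q₀ hq₀
    hqN hq2 hin hspl hCR hirr hκ₁ hκ₂ Ω δ Ωp LK G hΩ hδ hLK hGr J hJ ε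
  obtain ⟨xi, Lsig, hne, hpkg⟩ := h2 ι W K v vbar κ₁ κ₂ γ₁ γ₂ f hf hN hp2 hpN ha0 hIQ hsp hv hvbar hvv hι hcop
    h5 hX6 q₀ hq₀ hqN hq2 hin hspl hCR hirr hκ₁ hκ₂ Ω δ Ωp LK G hΩ hδ hLK hGr J hJ ε
  obtain ⟨hG0, hES⟩ := h3 ι W K v vbar κ₁ κ₂ γ₁ γ₂ f hf hN hp2 hpN ha0 hIQ hsp hv hvbar hvv hι hcop
    h5 hX6 q₀ hq₀ hqN hq2 hin hspl hCR hirr hκ₁ hκ₂ Ω δ Ωp LK G hΩ hδ hLK hGr J hJ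
  have hdiv := h4 ι W K v vbar κ₁ κ₂ γ₁ γ₂ f hf hN hp2 hpN ha0 hIQ hsp hv hvbar hvv hι hcop
    h5 hX6 q₀ hq₀ hqN hq2 hin hspl hCR hirr hκ₁ hκ₂ Ω δ Ωp LK G hΩ hδ hLK hGr J hJ ε xi Lsig hne hpkg
  refine ⟨xi, Lsig, ?_, hpkg⟩
  have hP : (WeierstrassCurve.XGr₂.charIdeal (W.baseChange K) p κ₁ κ₂ vbar γ₁ γ₂).IsPrincipal :=
    charIdealIsPrincipal₂ p _
  have hI : ((WeierstrassCurve.XGr₂.charIdeal (W.baseChange K) p κ₁ κ₂ vbar γ₁ γ₂).map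
      (IwasawaAlgebra₂.toUnr₂ p J)).IsPrincipal := by
    obtain ⟨⟨c, hc⟩⟩ := hP
    have hc' : WeierstrassCurve.XGr₂.charIdeal (W.baseChange K) p κ₁ κ₂ vbar γ₁ γ₂ = Ideal.span {c} := hc
    refine ⟨⟨IwasawaAlgebra₂.toUnr₂ p J c, ?_⟩⟩
    rw [hc', Ideal.map_span, Set.image_singleton]
  exact associated_of_signedLineAnchor hI hpkg.1 hES hG0 hne hdiv


/-! ### §5 The remaining stubs of the line: S1 field supply, S5 descent, S6 named inputs, S7 the `p = 3` residual -/

/-- **S1 `stub_definiteFieldSupply` (designed; elementary + Ribet level lowering, NO open input):** for `(W, p)` on X6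
at `5 ≤ p` with `N = N_W`, a DEFINITE strong-CR imaginary quadratic datum exists: `K` with `p = v v̄` split (`v`
induced by `ι`), one prime `q₀ ∥ N` inert, all other `ℓ ∣ N` split, `(N, D_K) = 1`, the CR disjunct at `q₀`,
`ρ̄|_{G_K}` absolutely irreducible on `E[p]`-type representations, and `ℤ_p²`-tower data with `γ₁` canonical.
Why it might fail: only if the tree lacks a construction of `(κ₁, κ₂, γ₁, γ₂)` for an imaginary quadratic `K`
(definitional supply, cf. `MuZeroCMKatzFrame.exists_isCyclotomic_isTopGenerator_normalised`); the arithmetic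
(`∃ q₀ ∥ N` with `p ∤ v_{q₀}(Δ)` on X6, `p ≥ 5`) is Ribet 1990 Thm 1.1 + `S₂(SL₂(ℤ)) = 0`. Nothing asserted. -/
def DefiniteFieldSupply : Prop :=
  ∀ (p : ℕ) [Fact p.Prime] (W : WeierstrassCurve ℚ) [W.IsElliptic] [W.IsGloballyMinimal] (N : ℕ),
    (N : ℤ) = W.conductorNorm ℤ → 5 ≤ p → Rank1Residual.ClassX6 W p →
    ∃ (K : Type) (_ : Field K) (_ : NumberField K) (ι : PadicAlgCl p ≃+* ℂ)
      (v vbar : HeightOneSpectrum (𝓞 K)) (κ₁ κ₂ : ZpExtension K p) (γ₁ γ₂ : absoluteGaloisGroup K)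
      (_ : Fact (ZpExtension.IsTopGeneratorPair κ₁ κ₂ γ₁ γ₂)) (_ : NeZero (NumberField.discr K).natAbs)
      (q₀ : ℕ),
      IsImaginaryQuadratic K ∧ ((Ideal.span {(p : ℤ)}).primesOver (𝓞 K)).ncard = 2 ∧
      ((p : ℕ) : 𝓞 K) ∈ v.asIdeal ∧ ((p : ℕ) : 𝓞 K) ∈ vbar.asIdeal ∧ vbar ≠ v ∧
      (∀ (w : InfinitePlace K) (k : 𝓞 K), k ∈ v.asIdeal ↔ ‖ι.symm (w.embedding (k : K))‖ < 1) ∧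
      IsCoprime (N : ℤ) (NumberField.discr K) ∧
      q₀.Prime ∧ q₀ ∣ N ∧ ¬ (q₀ ^ 2 ∣ N) ∧
      ((Ideal.span {(q₀ : ℤ)}).primesOver (𝓞 K)).ncard = 1 ∧
      (∀ ℓ : ℕ, ℓ.Prime → ℓ ∣ N → ℓ ≠ q₀ → ((Ideal.span {(ℓ : ℤ)}).primesOver (𝓞 K)).ncard = 2) ∧
      (¬ ((p : ℤ) ∣ padicValRat q₀ W.Δ) ∨ ¬ (q₀ ^ 2 ≡ 1 [MOD p])) ∧
      (∀ ρ : ModPGaloisRep K (ZMod p) 2, (W.baseChange K).IsTorsionGaloisRep p ρ →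
        FramedRep.IsAbsolutelyIrreducible ρ) ∧
      κ₁.IsCyclotomic ∧ κ₂.IsAnticyclotomic ∧
      (∃ ζ : ℤ_[p]ˣ, IsOfFinOrder ζ ∧
        ((GaloisRep.cyclotomicCharacter K p γ₁ * ζ : ℤ_[p]ˣ) : ℤ_[p]) = (cyclotomicGenerator p : ℤ_[p]))

/-- **S5 `DefiniteDescent` (PROVED in §7, rev 2 — `definiteDescent`; the 2-factor K2R⁗ — cyclotomic specialisation,
descent `𝒪_{ℂ_p}⟦T⟧ → Λ`, Kato–Rohrlich squeeze):** granted Kobayashi Thm 1.2 / Thm 4.1, modularity and the period unit BY NAME, for every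
`p`-split imaginary quadratic datum of `(W, p)` on X6 at `5 ≤ p` with canonical `γ₁`, every frame and structure map,
every sign `ε` and every two-variably ASSOCIATED package pair `ξ_∘ ~ 𝓛^∘` satisfying (P1)–(P3): Kobayashi's main
conjecture for `(W, p, ε)`. Template (4 factors, X7, PROVED): `SignedBaseChangeK2RTransferDescent.
productLowerDivisibility_of_package` + `SignedBaseChangeEisensteinSqueeze.X7.kobayashiMainConjecture_of_
productLowerDivisibility`; here 2 factors `(W, W^{(D_K)})`, `Surj` from `ClassX6.surj` and for the twist from the
twist relation (`goodSS_surj_of_smul_eq_quadraticTwist_discr`). No longer a stub: see `definiteDescent`. -/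
def DefiniteDescent : Prop :=
  Kobayashi2003.thm12_signedSelmerDual_finite_torsion → Kobayashi2003.thm41_signedCharIdeal_divisibility →
  nonempty_modularParametrizationData → realPeriodRat_eq_unit_mul_plusPeriod →
  ∀ {p : ℕ} [Fact p.Prime] (ι : PadicAlgCl p ≃+* ℂ) (W : WeierstrassCurve ℚ) [W.IsElliptic]
    [W.IsGloballyMinimal] (K : Type) [Field K] [NumberField K] (v vbar : HeightOneSpectrum (𝓞 K))
    (κ₁ κ₂ : ZpExtension K p) (γ₁ γ₂ : absoluteGaloisGroup K)
    [Fact (ZpExtension.IsTopGeneratorPair κ₁ κ₂ γ₁ γ₂)] {N : ℕ} [NeZero N] (f : CuspForm (Gamma0 N) 2)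
    [NeZero (NumberField.discr K).natAbs],
    IsNewformOf W f → (N : ℤ) = W.conductorNorm ℤ → p ≠ 2 → ¬ (p : ℤ) ∣ W.conductorNorm ℤ →
    W.frobeniusTrace p = 0 →
    IsImaginaryQuadratic K → ((Ideal.span {(p : ℤ)}).primesOver (𝓞 K)).ncard = 2 →
    ((p : ℕ) : 𝓞 K) ∈ v.asIdeal → ((p : ℕ) : 𝓞 K) ∈ vbar.asIdeal → vbar ≠ v →
    (∀ (w : InfinitePlace K) (k : 𝓞 K), k ∈ v.asIdeal ↔ ‖ι.symm (w.embedding (k : K))‖ < 1) →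
    IsCoprime (N : ℤ) (NumberField.discr K) →
    5 ≤ p → Rank1Residual.ClassX6 W p →
    (∀ ρ : ModPGaloisRep K (ZMod p) 2, (W.baseChange K).IsTorsionGaloisRep p ρ →
      FramedRep.IsAbsolutelyIrreducible ρ) →
    κ₁.IsCyclotomic → κ₂.IsAnticyclotomic →
    -- «γ₁ canonical»
    (∃ ζ : ℤ_[p]ˣ, IsOfFinOrder ζ ∧
      ((GaloisRep.cyclotomicCharacter K p γ₁ * ζ : ℤ_[p]ˣ) : ℤ_[p]) = (cyclotomicGenerator p : ℤ_[p])) →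
    ∀ (Ω δ : ℂ) (Ωp : (unrIntegers p)ˣ) (LK G : PowerSeries (PowerSeries (PadicComplexInt p))),
      Ω ≠ 0 → (δ ^ 2 = (NumberField.discr K : ℂ) ∨ δ ^ 2 = -(NumberField.discr K : ℂ)) →
      IsKatzMeasure₂ ι v vbar ∅ κ₁ κ₂ γ₁⁻¹ γ₂⁻¹ 1 Ω δ ((Ωp : unrIntegers p) : PadicComplex p) LK →
      IsGreenbergLFunctionAnyRoot₂ ι v vbar κ₁ κ₂ γ₁⁻¹ γ₂⁻¹ f (NumberField.discr K).natAbs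
        (NumberField.classNumber K) LK G →
    ∀ J : ℤ_[p] →+* PadicComplexInt p,
      (∀ x : ℤ_[p], ((J x : PadicComplexInt p) : PadicComplex p) = ((x : ℚ_[p]) : PadicComplex p)) →
    ∀ ε : ℤˣ,
    ∀ xi Lsig : PowerSeries (PowerSeries (PadicComplexInt p)),
      Associated xi Lsig →
      (Ideal.span {xi * G} =
          (WeierstrassCurve.XGr₂.charIdeal (W.baseChange K) p κ₁ κ₂ vbar γ₁ γ₂).map
              (IwasawaAlgebra₂.toUnr₂ p J) * Ideal.span {Lsig} ∧
      ∀ (κ : ZpExtension ℚ p) (γ : absoluteGaloisGroup ℚ), κ.IsCyclotomic → κ.IsTopGenerator γ →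
        IsCyclotomicVariable p γ →
        (∃ ζ : ℤ_[p]ˣ, IsOfFinOrder ζ ∧
          GaloisRep.cyclotomicCharacter ℚ p γ * ζ = GaloisRep.cyclotomicCharacter K p γ₁) →
        ∀ (W₂ : WeierstrassCurve ℚ) [W₂.IsElliptic] [W₂.IsGloballyMinimal]
          (C₂ : WeierstrassCurve.VariableChange ℚ),
          C₂ • W₂ = W.quadraticTwist (NumberField.discr K : ℚ) →
          (∀ (D₁ : Kobayashi2003.SignedSelmerDualData W κ γ ε)
              (D₂ : Kobayashi2003.SignedSelmerDualData W₂ κ γ ε) (g₁ g₂ : IwasawaAlgebra p),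
              D₁.charIdeal = Ideal.span {g₁} → D₂.charIdeal = Ideal.span {g₂} →
              UnrSeries₂.plus xi ∣ PowerSeries.map J (g₁ * g₂)) ∧
          (∀ {N₂ : ℕ} [NeZero N₂] (f₂ : CuspForm (Gamma0 N₂) 2), IsNewformOf W₂ f₂ →
            ∀ (L₁ L₂ : IwasawaAlgebra p), Kobayashi2003.IsSignedPAdicLFunction f p ε L₁ →
              Kobayashi2003.IsSignedPAdicLFunction f₂ p ε L₂ →
              ∃ u : PowerSeries (PadicComplexInt p), IsUnit u ∧
                UnrSeries₂.plus Lsig = u * PowerSeries.map J (L₁ * L₂))) →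
      Summit.BirchSwinnertonDyer.Rank1Residual.Supersingular.KobayashiMainConjecture W p ε

/-- **S6 `stub_namedInputs` (HELD, cite-only, BY NAME):** BSTW Thm 6.17 frame existence (PRE, OPEN binder — never a
theorem), Kobayashi 2003 Thm 1.2 and Thm 4.1 (PUB), modularity with integral Manin constant (PUB), and the period unit
`Ω_E / Ω_f⁺ ∈ ℤ_(p)^×` (PUB; the conjunct of `BirthMuSplit.stub_periodFacts`). Nothing asserted. -/
def NamedInputs : Prop :=
  thm617_exists_isGreenbergLFunctionAnyRoot₂_supersingular_PRE ∧
  Kobayashi2003.thm12_signedSelmerDual_finite_torsion ∧ Kobayashi2003.thm41_signedCharIdeal_divisibility ∧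
  nonempty_modularParametrizationData ∧ realPeriodRat_eq_unit_mul_plusPeriod

/-- **S7 `stub_threeResidual` (RESIDUAL, BY NAME = `BirthMuSplit.three` of the skeleton of record, i.e.
`stub_three_rational ∧ stub_three_mu ∘ MuSplit`):** the `p = 3`, `a₃ = 0` branch of the crux. This line contributes
nothing here (NoAdmissiblePrimesAtThree). Nothing asserted. -/
def ThreeResidual : Prop :=
  ∀ (W : WeierstrassCurve ℚ) [W.IsElliptic] [W.IsGloballyMinimal], Rank1Residual.ClassX6 W 3 →
    ∃ ε : ℤˣ, Summit.BirchSwinnertonDyer.Rank1Residual.Supersingular.KobayashiLowerDivisibility W 3 ε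

/-! ### §6 The composition, PROVED: S1 → … → S7 → `KobayashiLowerHalfSemistable` -/

/-- **The `5 ≤ p` branch from the definite anchor:** field supply + anchor + descent + named inputs give Kobayashi's
main conjecture for `(W, p, ε = 1)` — in particular its Eisenstein half for one sign. -/
theorem five_le_of_defAnchor (h1 : DefiniteFieldSupply) (hA : DefAnchor) (h5 : DefiniteDescent) (h6 : NamedInputs)
    (W : WeierstrassCurve ℚ) [W.IsElliptic] [W.IsGloballyMinimal] (p : ℕ) [Fact p.Prime]
    (hp : p ≠ 2) (hX : Rank1Residual.ClassX6 W p) (h5p : 5 ≤ p) :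
    ∃ ε : ℤˣ, Summit.BirchSwinnertonDyer.Rank1Residual.Supersingular.KobayashiLowerDivisibility W p ε := by
  obtain ⟨h617, h12, h41, hmod, hper⟩ := h6
  haveI : NeZero (W.conductorNorm ℤ) := ⟨(W.conductorNorm_pos_holds).ne'⟩
  obtain ⟨π⟩ := hmod W
  -- the local facts at `p` read off the class: good supersingular reduction, `p ∤ N_W`, `a_p = 0` (`p ≥ 5`)
  have hgood : W.HasGoodReductionAtPrime p := hX.1.1
  have hpN' : ¬ p ∣ W.conductorNorm ℤ := not_dvd_conductorNorm_of_hasGoodReductionAtPrime W hgood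
  have hpN : ¬ (p : ℤ) ∣ W.conductorNorm ℤ := by exact_mod_cast hpN'
  have ha0 : W.frobeniusTrace p = 0 := (W.natCast_dvd_frobeniusTrace_iff_eq_zero p h5p hgood).mp hX.1.2
  have hN : ((W.conductorNorm ℤ : ℕ) : ℤ) = W.conductorNorm ℤ := rfl
  -- S1: the definite strong-CR field datum
  obtain ⟨K, _, _, ι, v, vbar, κ₁, κ₂, γ₁, γ₂, _, _, q₀, hIQ, hsp, hv, hvbar, hvv, hι, hcop, hq₀, hqN, hq2, hin,
    hspl, hCR, hirr, hκ₁, hκ₂, hcan⟩ := h1 p W (W.conductorNorm ℤ) hN h5p hX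
  -- S6.1: a Katz/Greenberg frame for `π.f` over `K`
  obtain ⟨Ω, δ, Ωp, LK, G, hΩ, hδ, hLK, hGr⟩ :=
    h617 ι W K v vbar κ₁ κ₂ γ₁ γ₂ π.isNewformOf hN h5p hpN ha0 hIQ hsp hv hvbar hvv hι hcop hκ₁ hκ₂
  -- a structure map `J : ℤ_p → 𝒪_{ℂ_p}`
  obtain ⟨J, hJ⟩ := exists_structureMap_padicInt (p := p)
  refine ⟨1, Summit.BirchSwinnertonDyer.Rank1Residual.Supersingular.kobayashiLowerDivisibility_of_mainConjecture ?_⟩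
  -- the anchor: an ASSOCIATED package pair for `ε = 1`
  obtain ⟨xi, Lsig, hassoc, hpkg⟩ := hA ι W K v vbar κ₁ κ₂ γ₁ γ₂ π.f π.isNewformOf hN hp hpN ha0 hIQ hsp hv
    hvbar hvv hι hcop h5p hX q₀ hq₀ hqN hq2 hin hspl hCR hirr hκ₁ hκ₂ Ω δ Ωp LK G hΩ hδ hLK hGr J hJ 1
  -- S5: descend and squeeze
  exact h5 h12 h41 hmod hper ι W K v vbar κ₁ κ₂ γ₁ γ₂ π.f π.isNewformOf hN hp hpN ha0 hIQ hsp hv hvbar hvv hι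
    hcop h5p hX hirr hκ₁ hκ₂ hcan Ω δ Ωp LK G hΩ hδ hLK hGr J hJ 1 xi Lsig hassoc hpkg

/-- **The composition of line «defanchor», PROVED:** the seven stubs imply the crux `KobayashiLowerHalfSemistable`
BY NAME (`5 ≤ p`: S1–S6 via `defAnchor_of` and `five_le_of_defAnchor`; `p = 3`: S7; `p = 2`/`p = 4`: excluded). -/
theorem kobayashiLowerHalfSemistable_of_defanchor (h1 : DefiniteFieldSupply) (h2 : DefinitePackage)
    (h3 : ES2Definite) (h4 : DefiniteLineEisenstein) (h5 : DefiniteDescent) (h6 : NamedInputs)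
    (h7 : ThreeResidual) :
    Summit.BirchSwinnertonDyer.BirchSwinnertonDyer.Theses.SignedLowerHalves.KobayashiLowerHalfSemistable := by
  intro W _ _ p hpF hp hX
  by_cases h : 5 ≤ p
  · exact five_le_of_defAnchor h1 (defAnchor_of h2 h3 h4) h5 h6 W p hp hX h
  · have h2le := hpF.out.two_le
    have hlt : p < 5 := Nat.lt_of_not_le h
    interval_cases p
    · exact absurd rfl hp
    · exact h7 W hX
    · exact absurd hpF.out (by decide)


/-! ### §7 (rev 2) S5 DISCHARGED: `DefiniteDescent` is PROVED, and the composition with SIX hypotheses -/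

open scoped MatrixGroups ModularForm in
open WeierstrassCurve Literature.NumberTheory.EllipticCurves.Rank1Residual
  Literature.NumberTheory.EllipticCurves.BurungaleCastellaSkinner2025
  Literature.NumberTheory.EllipticCurves.Kobayashi2003 ZpExtension
  Summit.BirchSwinnertonDyer.Rank1Residual.Supersingular
  Summit.BirchSwinnertonDyer.BirchSwinnertonDyer.Theorems.SignedBaseChangeEisensteinSqueeze
  Summit.BirchSwinnertonDyer.BirchSwinnertonDyer.Theorems.SignedBaseChangeAuxiliaryCurves
  Summit.BirchSwinnertonDyer.BirchSwinnertonDyer.Theorems.SignedBaseChangeK2RTransferDescent in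
/-- **S5 holds (PROVED).** Two-factor K2R⁗ from the association: `𝓛^∘ ∣ ξ_∘` two-variably; on the cyclotomic line
(P2) + (P3) give `J(L^ε(f)·L^ε(f₂)) ∣ J(g₁·g₂)` in `𝒪_{ℂ_p}⟦T⟧`, which descends to `Λ`
(`iwasawaAlgebra_dvd_of_map_dvd_map_padicComplexInt`); Kato (Thm 4.1, integral under `Surj` from `ClassX6.surj` and its
twist-stability) bounds each factor the other way; the two-factor squeeze and the Néron normalisation finish.
[cite: BurungaleSkinnerTianWan2024, §2.3 proof of Thm. (KoMC_r)] [cite: Kobayashi2003, Thm. 1.2, Thm. 4.1 (p. 8)]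
[cite: GreenbergVatsal2000, §3 Remark 3.4] -/
theorem definiteDescent : DefiniteDescent := by
  intro h12 h41 hmod h5 p _ ι W _ _ K _ _ v vbar κ₁ κ₂ γ₁ γ₂ _ N _ f _ hf hN hp2 hpN hap hK hsplit hv hvbar hvv
    hι hcop hp5 hX hirr hκ₁ hκ₂ hcan Ω δ Ωp LK G hΩ hδ hLK hG J hJ ε xi Ls hassoc hpkg
  obtain ⟨hP1, hline⟩ := hpkg
  -- basics at `p` for `W` (X6 ⇒ good supersingular, `ρ̄` onto, `E[p]` irreducible)
  have hpP : p.Prime := Fact.out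
  have hgood : W.HasGoodReductionAtPrime p := hX.1.1
  have hs : Surj W p := ClassX6.surj W p hp2 hX
  have hirrW : Irr W p := ClassX6.irr W p hp2 hX
  -- the auxiliary curve `W₂ ≃ W^{(D_K)}`: good at `p`, `a_p = 0`, `ρ̄` onto (`p ∤ D_K` as `p` splits)
  have hpD : ¬ (p : ℤ) ∣ NumberField.discr K := not_dvd_discr_of_ncard_primesOver_eq_two hK.1 hpP hsplit
  have hD0 : (NumberField.discr K : ℚ) ≠ 0 := by exact_mod_cast NumberField.discr_ne_zero K
  obtain ⟨W₂, _, _, C₂, hC₂⟩ := exists_isGloballyMinimal_smul_eq_quadraticTwist W hD0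
  obtain ⟨hgood₂, hap₂, hs₂⟩ :=
    goodSS_surj_of_smul_eq_quadraticTwist_discr hK.1 W W₂ p hp2 hpD hC₂ hgood hap hs
  -- levels = conductors: Kobayashi's conjecture binds the conductor-level newform, which is `f` (uniqueness)
  have hNn : N = W.conductorNorm ℤ := by exact_mod_cast hN
  subst hNn
  intro κ γ hκ hγ hγ' _ fK hfK ϖ hϖ Lp Lm hPP D
  have hfeq : f = fK := hf.unique hfK
  subst hfeq
  -- Thm. 1.2 for `W`
  haveI hfin : Module.Finite (IwasawaAlgebra p) D.X := h12.moduleFinite hp2 hgood hap hκ hγ D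
  have hXt : Module.IsTorsion (IwasawaAlgebra p) D.X := h12.isTorsion hp2 hgood hap hκ hγ D
  refine ⟨hXt, ?_⟩
  obtain ⟨g₁, hg₁⟩ := (charIdeal_isPrincipal_holds p D.X).principal
  have hg₁' : D.charIdeal = Ideal.span {g₁} := hg₁
  -- auxiliary data for `W₂`: newform (modularity), Pollack pair, Selmer datum, generator
  haveI : NeZero (W₂.conductorNorm ℤ) := ⟨(W₂.conductorNorm_pos_holds).ne'⟩
  obtain ⟨Dm₂⟩ := hmod W₂
  obtain ⟨Lp₂, Lm₂, hPP₂⟩ :=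
    exists_isPollackPair pollack_exists_plusMinusPAdicLFunction_holds hp2 Dm₂.isNewformOf hgood₂ hap₂
  obtain ⟨D₂⟩ := nonempty_signedSelmerDualData W₂ κ ε hγ
  obtain ⟨g₂, hg₂⟩ := (charIdeal_isPrincipal_holds p D₂.X).principal
  have hg₂' : D₂.charIdeal = Ideal.span {g₂} := hg₂
  -- the cyclotomic-line clauses (P2), (P3) for `(W, W₂)` at the canonical `ℚ`-variable `γ`
  have hcoord := exists_isOfFinOrder_mul_eq_of_canonical hcan hγ'
  obtain ⟨hP2, hP3⟩ := hline κ γ hκ hγ hγ' hcoord W₂ C₂ hC₂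
  have hL₁ := hPP.isSignedPAdicLFunction_kobayashiL ε
  have hL₂ := hPP₂.isSignedPAdicLFunction_kobayashiL ε
  have h2 := hP2 D D₂ g₁ g₂ hg₁' hg₂'
  obtain ⟨u, hu, h3⟩ := hP3 Dm₂.f Dm₂.isNewformOf _ _ hL₁ hL₂
  -- from the two-variable association: `𝓛^∘ ∣ ξ_∘`, then descend through `plus` with (P2), (P3)
  have hdvd : Ls ∣ xi := hassoc.symm.dvd
  have hS : PowerSeries.map J (kobayashiL ε Lp Lm * kobayashiL ε Lp₂ Lm₂) * 1 ∣
      PowerSeries.map J (g₁ * g₂) * 1 :=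
    mul_dvd_mul_of_map_of_dvd_of_eq_unit_mul
      (PowerSeries.map (PowerSeries.constantCoeff (R := PadicComplexInt p)))
      (ξ' := 1) (L' := 1) (a' := 1) (b' := 1) (u' := 1)
      (by simpa using hdvd) h2 (by simp) hu isUnit_one h3 (by simp)
  rw [mul_one, mul_one] at hS
  -- descend to `ℤ_p⟦T⟧`
  have hZ : kobayashiL ε Lp Lm * kobayashiL ε Lp₂ Lm₂ ∣ g₁ * g₂ :=
    Summit.BirchSwinnertonDyer.BirchSwinnertonDyer.Theorems.SignedBaseChangeK2RDivisibilityDescent.iwasawaAlgebra_dvd_of_map_dvd_map_padicComplexInt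
      hJ hS
  -- Kobayashi Thm. 4.1 (integral under `Surj`) for `W` and `W₂`
  have hL20 := Wuthrich2014.lemma20_surjective_threeAdic_of_semistable_holds
  have hK₁ : g₁ ∣ kobayashiL ε Lp Lm :=
    h41.dvd_of_charIdeal_eq_span hp2 hgood hap hfK hκ hγ hγ' hL₁ D hXt
      (surjective_pow_of_surj_of_good W p hL20 hp2 hgood hs) hg₁'
  haveI : Module.Finite (IwasawaAlgebra p) D₂.X := h12.moduleFinite hp2 hgood₂ hap₂ hκ hγ D₂
  have hK₂ : g₂ ∣ kobayashiL ε Lp₂ Lm₂ :=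
    h41.dvd_of_charIdeal_eq_span hp2 hgood₂ hap₂ Dm₂.isNewformOf hκ hγ hγ' hL₂ D₂
      (h12.isTorsion hp2 hgood₂ hap₂ hκ hγ D₂) (surjective_pow_of_surj_of_good W₂ p hL20 hp2 hgood₂ hs₂) hg₂'
  -- two-factor squeeze: `(g₁) = (L^ε(f))`
  have hassoc₁ : Associated g₁ (kobayashiL ε Lp Lm) :=
    associated_of_dvd_of_mul4_dvd (g₃ := 1) (g₄ := 1) (L₃ := 1) (L₄ := 1) hK₁ hK₂ (dvd_refl 1) (dvd_refl 1)
      (kobayashiL_ne_zero hPP ε) (kobayashiL_ne_zero hPP₂ ε) one_ne_zero one_ne_zero (by simpa using hZ)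
  have hchar : D.charIdeal = Ideal.span {kobayashiL ε Lp Lm} := by
    rw [hg₁']; exact Ideal.span_singleton_eq_span_singleton.mpr hassoc₁
  -- Néron normalisation: `ϖ` is a `p`-adic unit
  set L := kobayashiL ε Lp Lm with hL_def
  have hvϖ : padicValRat p ϖ = 0 :=
    padicValRat_periodRatio_eq_zero_of_five_le h5 W p hp5 hgood hirrW _ hfK ϖ hϖ
  have hϖ0 : ϖ ≠ 0 := by
    intro hz
    rw [hz, Rat.cast_zero, zero_mul] at hϖ
    exact (IsNewform0.plusPeriod_pos_holds hfK.1 hfK.coeffField_eq_bot).ne' hϖ.symm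
  obtain ⟨u₁, hu₁⟩ := exists_units_coe_eq_ratCast hϖ0 hvϖ
  obtain ⟨hspan', hι'⟩ := span_C_units_mul_eq u₁ L
  refine ⟨PowerSeries.C (u₁ : ℤ_[p]) * L, ?_, ?_⟩
  · rw [hchar, hspan']
  · rw [hι', hu₁]

/-- **The composition of line «defanchor» with S5 discharged (rev 2), PROVED:** S1, S2, S3, S4, S6 (held by name)
and S7 (the `p = 3` residual) imply the crux `KobayashiLowerHalfSemistable` BY NAME. At adoption the skeleton has
six `stub_*` (four with open content at `p ≥ 5`: S1 elementary, S2 PRE + non-vanishing, S3 ES2 twin + `G ≠ 0`,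
S4 the wall) and `KobayashiLowerHalfSemistable_of := kobayashiLowerHalfSemistable_of_defanchor₆ stub_s1 … stub_s7`. -/
theorem kobayashiLowerHalfSemistable_of_defanchor₆ (h1 : DefiniteFieldSupply) (h2 : DefinitePackage)
    (h3 : ES2Definite) (h4 : DefiniteLineEisenstein) (h6 : NamedInputs) (h7 : ThreeResidual) :
    Summit.BirchSwinnertonDyer.BirchSwinnertonDyer.Theses.SignedLowerHalves.KobayashiLowerHalfSemistable :=
  kobayashiLowerHalfSemistable_of_defanchor h1 h2 h3 h4 definiteDescent h6 h7


/-! ### §8 (rev 3) S3 WEAKENED to the bare inclusion: `G ≠ 0` is FREE from the package ((P1) + `minus 𝓛^∘ ≠ 0`) -/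

/-- **S3′ `ES2DefiniteIncl` (rev 3; the stub to register instead of S3):** the integral two-variable Euler-system
inclusion `(G) ⊆ ch(X_Gr₂(E/K_∞))^ur` ALONE, for the definite-CR datum — literally the definite twin of
`SignedBaseChange.TwoVariableEulerSystemDivisibility` (stmt-BirchSwinnertonDyer-20728), same conclusion shape, no `G ≠ 0`
conjunct (that conjunct of S3 follows from S2: (P1) `(ξ_∘·G) = ch·(𝓛^∘)` with `ch ≠ ⊥` and `𝓛^∘ ≠ 0`, see
`es2Definite_of_incl`). Nothing asserted. -/
def ES2DefiniteIncl : Prop :=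
  ∀ {p : ℕ} [Fact p.Prime] (ι : PadicAlgCl p ≃+* ℂ) (W : WeierstrassCurve ℚ) [W.IsElliptic]
    [W.IsGloballyMinimal] (K : Type) [Field K] [NumberField K] (v vbar : HeightOneSpectrum (𝓞 K))
    (κ₁ κ₂ : ZpExtension K p) (γ₁ γ₂ : absoluteGaloisGroup K)
    [Fact (ZpExtension.IsTopGeneratorPair κ₁ κ₂ γ₁ γ₂)] {N : ℕ} [NeZero N] (f : CuspForm (Gamma0 N) 2)
    [NeZero (NumberField.discr K).natAbs],
    IsNewformOf W f → (N : ℤ) = W.conductorNorm ℤ → p ≠ 2 → ¬ (p : ℤ) ∣ W.conductorNorm ℤ →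
    W.frobeniusTrace p = 0 →
    IsImaginaryQuadratic K → ((Ideal.span {(p : ℤ)}).primesOver (𝓞 K)).ncard = 2 →
    ((p : ℕ) : 𝓞 K) ∈ v.asIdeal → ((p : ℕ) : 𝓞 K) ∈ vbar.asIdeal → vbar ≠ v →
    (∀ (w : InfinitePlace K) (k : 𝓞 K), k ∈ v.asIdeal ↔ ‖ι.symm (w.embedding (k : K))‖ < 1) →
    IsCoprime (N : ℤ) (NumberField.discr K) →
    -- ⟨definite-CR clauses (card G4 S1): X6 at 5 ≤ p; ONE prime q₀ ∥ N inert in K, every other ℓ ∣ N split;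
    --  (CR) ρ̄ ramified at q₀ (p ∤ v_{q₀}(Δ_W), Tate) or q₀² ≢ 1 (mod p)⟩
    5 ≤ p → Rank1Residual.ClassX6 W p →
    ∀ q₀ : ℕ, q₀.Prime → q₀ ∣ N → ¬ (q₀ ^ 2 ∣ N) →
      ((Ideal.span {(q₀ : ℤ)}).primesOver (𝓞 K)).ncard = 1 →
      (∀ ℓ : ℕ, ℓ.Prime → ℓ ∣ N → ℓ ≠ q₀ → ((Ideal.span {(ℓ : ℤ)}).primesOver (𝓞 K)).ncard = 2) →
      (¬ ((p : ℤ) ∣ padicValRat q₀ W.Δ) ∨ ¬ (q₀ ^ 2 ≡ 1 [MOD p])) →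
    (∀ ρ : ModPGaloisRep K (ZMod p) 2, (W.baseChange K).IsTorsionGaloisRep p ρ →
      FramedRep.IsAbsolutelyIrreducible ρ) →
    κ₁.IsCyclotomic → κ₂.IsAnticyclotomic →
    ∀ (Ω δ : ℂ) (Ωp : (unrIntegers p)ˣ) (LK G : PowerSeries (PowerSeries (PadicComplexInt p))),
      Ω ≠ 0 → (δ ^ 2 = (NumberField.discr K : ℂ) ∨ δ ^ 2 = -(NumberField.discr K : ℂ)) →
      IsKatzMeasure₂ ι v vbar ∅ κ₁ κ₂ γ₁⁻¹ γ₂⁻¹ 1 Ω δ ((Ωp : unrIntegers p) : PadicComplex p) LK →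
      IsGreenbergLFunctionAnyRoot₂ ι v vbar κ₁ κ₂ γ₁⁻¹ γ₂⁻¹ f (NumberField.discr K).natAbs
        (NumberField.classNumber K) LK G →
    ∀ J : ℤ_[p] →+* PadicComplexInt p,
      (∀ x : ℤ_[p], ((J x : PadicComplexInt p) : PadicComplex p) = ((x : ℚ_[p]) : PadicComplex p)) →
      Ideal.span {G} ≤
        (WeierstrassCurve.XGr₂.charIdeal (W.baseChange K) p κ₁ κ₂ vbar γ₁ γ₂).map (IwasawaAlgebra₂.toUnr₂ p J)

open Summit.BirchSwinnertonDyer.BirchSwinnertonDyer.Theorems.SignedBaseChangeK2RTransferDescent in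
/-- **S2 + S3′ ⇒ S3**: the package's (P1) with `ch(X_Gr₂)^ur ≠ ⊥` (`map_charIdealXGr₂_ne_bot`) and `𝓛^∘ ≠ 0`
(from `minus 𝓛^∘ ≠ 0`) force `G ≠ 0` (`ne_zero_of_span_mul_eq`). [cite: BurungaleSkinnerTianWan2024, Prop. 1.18 — bookkeeping] -/
theorem es2Definite_of_incl (h2 : DefinitePackage) (h3 : ES2DefiniteIncl) : ES2Definite := by
  intro p _ ι W _ _ K _ _ v vbar κ₁ κ₂ γ₁ γ₂ _ N _ f _ hf hN hp2 hpN ha0 hIQ hsp hv hvbar hvv hι hcop h5 hX6 q₀ hq₀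
    hqN hq2 hin hspl hCR hirr hκ₁ hκ₂ Ω δ Ωp LK G hΩ hδ hLK hGr J hJ
  obtain ⟨xi, Lsig, hne, hpkg⟩ := h2 ι W K v vbar κ₁ κ₂ γ₁ γ₂ f hf hN hp2 hpN ha0 hIQ hsp hv hvbar hvv hι hcop
    h5 hX6 q₀ hq₀ hqN hq2 hin hspl hCR hirr hκ₁ hκ₂ Ω δ Ωp LK G hΩ hδ hLK hGr J hJ 1
  have hLs : Lsig ≠ 0 := by
    rintro rfl
    exact hne (by simp [UnrSeries₂.minus])
  have hJinj : Function.Injective J := structureMap_injective hJ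
  refine ⟨ne_zero_of_span_mul_eq hpkg.1 (map_charIdealXGr₂_ne_bot _ κ₁ κ₂ vbar γ₁ γ₂ hJinj) hLs, ?_⟩
  exact h3 ι W K v vbar κ₁ κ₂ γ₁ γ₂ f hf hN hp2 hpN ha0 hIQ hsp hv hvbar hvv hι hcop h5 hX6 q₀ hq₀ hqN hq2 hin
    hspl hCR hirr hκ₁ hκ₂ Ω δ Ωp LK G hΩ hδ hLK hGr J hJ

/-- **The composition of line «defanchor», rev 3, PROVED — the form to register:** S1, S2, S3′ (bare ES2 inclusion),
S4, S6 (held), S7 (`p = 3` residual) imply the crux BY NAME; S5 is the theorem `definiteDescent`, the `G ≠ 0`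
conjunct of S3 is derived. Skeleton at adoption: six `stub_*` over `DefiniteFieldSupply`, `DefinitePackage`,
`ES2DefiniteIncl`, `DefiniteLineEisenstein`, `NamedInputs`, `ThreeResidual`, and `KobayashiLowerHalfSemistable_of :=
kobayashiLowerHalfSemistable_of_defanchor₆' stub_s1 stub_s2 stub_s3 stub_s4 stub_s6 stub_s7`. -/
theorem kobayashiLowerHalfSemistable_of_defanchor₆' (h1 : DefiniteFieldSupply) (h2 : DefinitePackage)
    (h3 : ES2DefiniteIncl) (h4 : DefiniteLineEisenstein) (h6 : NamedInputs) (h7 : ThreeResidual) :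
    Summit.BirchSwinnertonDyer.BirchSwinnertonDyer.Theses.SignedLowerHalves.KobayashiLowerHalfSemistable :=
  kobayashiLowerHalfSemistable_of_defanchor₆ h1 h2 (es2Definite_of_incl h2 h3) h4 h6 h7


/-! ### §9 (rev 4) S1 SPLIT (critic VERDICT #21 price P1): S1a the level prime (PUB: Ribet / Serre–Khare–Wintenberger)
### + S1b the field/tower supply (elementary), with `definiteFieldSupply_of : S1a → S1b → S1` PROVED -/

/-- **S1a `RamifiedLevelPrime` (PUB BY NAME — Ribet's level lowering; the one non-elementary input of S1, isolated per
idea-crit-14 VERDICT #21 (P1)):** for `(W, p)` on X6 at `5 ≤ p` some prime `q₀ ∣ N_W` satisfies the CR disjunct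
`p ∤ v_{q₀}(Δ_W)` (i.e. `ρ̄_{E,p}` RAMIFIED at `q₀`, Tate) or `q₀² ≢ 1 (mod p)`. Why true: if every `q ∣ N` had
`p ∣ v_q(Δ_min)` then `ρ̄_{E,p}` (irreducible: `ClassX6.irr`; finite flat at the good prime `p`) would be unramified
outside `p` with Serre invariants `(N(ρ̄), k(ρ̄)) = (1, 2)`, hence modular of level 1 and weight 2 by Ribet's theorem
(or by Serre's conjecture, tree name `khare_wintenberger`), contradicting `S₂(SL₂(ℤ)) = 0`. Not typed as a Literature
fact in the tree today (level lowering appears only in the generalized-Fermat files, `levelLowering_of_khare_wintenberger`,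
in a `Γ₁`/Serre-weight shape); a typer may land it, after which this stub closes BY NAME. Nothing asserted.
[cite: Ribet1990, Thm. 1.1] [cite: KhareWintenberger2009, Thm. 1.2] [cite: Serre1987, (3.2.4) and §4.1] -/
def RamifiedLevelPrime : Prop :=
  ∀ (p : ℕ) [Fact p.Prime] (W : WeierstrassCurve ℚ) [W.IsElliptic] [W.IsGloballyMinimal],
    5 ≤ p → Rank1Residual.ClassX6 W p →
    ∃ q₀ : ℕ, q₀.Prime ∧ (q₀ : ℤ) ∣ W.conductorNorm ℤ ∧
      (¬ ((p : ℤ) ∣ padicValRat q₀ W.Δ) ∨ ¬ (q₀ ^ 2 ≡ 1 [MOD p]))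

/-- **S1b `DefiniteFieldSupplyFrom` (elementary: Dirichlet + CRT + quadratic reciprocity + the `ℤ_p²`-tower supply;
M-sized):** GIVEN a prime `q₀ ∣ N_W` with the CR disjunct, the definite strong-CR datum of S1 exists with THIS `q₀`
inert: `K` imaginary quadratic with `p` split, `q₀` inert, every other `ℓ ∣ N` split, `(N, D_K) = 1`, `q₀ ∥ N`
(from semistability on X6), `ρ̄|_{G_K}` absolutely irreducible (`ClassX6.surj`, `K ∩ ℚ(ζ_p) = ℚ`), tower data with
`γ₁` canonical, `ι` inducing `v`. Nothing asserted. [Dirichlet's theorem; CRT; Serre 1972 §5.4] -/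
def DefiniteFieldSupplyFrom : Prop :=
  ∀ (p : ℕ) [Fact p.Prime] (W : WeierstrassCurve ℚ) [W.IsElliptic] [W.IsGloballyMinimal] (N : ℕ),
    (N : ℤ) = W.conductorNorm ℤ → 5 ≤ p → Rank1Residual.ClassX6 W p →
    ∀ q₀ : ℕ, q₀.Prime → (q₀ : ℤ) ∣ W.conductorNorm ℤ →
      (¬ ((p : ℤ) ∣ padicValRat q₀ W.Δ) ∨ ¬ (q₀ ^ 2 ≡ 1 [MOD p])) →
    ∃ (K : Type) (_ : Field K) (_ : NumberField K) (ι : PadicAlgCl p ≃+* ℂ)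
      (v vbar : HeightOneSpectrum (𝓞 K)) (κ₁ κ₂ : ZpExtension K p) (γ₁ γ₂ : absoluteGaloisGroup K)
      (_ : Fact (ZpExtension.IsTopGeneratorPair κ₁ κ₂ γ₁ γ₂)) (_ : NeZero (NumberField.discr K).natAbs),
      IsImaginaryQuadratic K ∧ ((Ideal.span {(p : ℤ)}).primesOver (𝓞 K)).ncard = 2 ∧
      ((p : ℕ) : 𝓞 K) ∈ v.asIdeal ∧ ((p : ℕ) : 𝓞 K) ∈ vbar.asIdeal ∧ vbar ≠ v ∧
      (∀ (w : InfinitePlace K) (k : 𝓞 K), k ∈ v.asIdeal ↔ ‖ι.symm (w.embedding (k : K))‖ < 1) ∧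
      IsCoprime (N : ℤ) (NumberField.discr K) ∧
      q₀.Prime ∧ q₀ ∣ N ∧ ¬ (q₀ ^ 2 ∣ N) ∧
      ((Ideal.span {(q₀ : ℤ)}).primesOver (𝓞 K)).ncard = 1 ∧
      (∀ ℓ : ℕ, ℓ.Prime → ℓ ∣ N → ℓ ≠ q₀ → ((Ideal.span {(ℓ : ℤ)}).primesOver (𝓞 K)).ncard = 2) ∧
      (¬ ((p : ℤ) ∣ padicValRat q₀ W.Δ) ∨ ¬ (q₀ ^ 2 ≡ 1 [MOD p])) ∧
      (∀ ρ : ModPGaloisRep K (ZMod p) 2, (W.baseChange K).IsTorsionGaloisRep p ρ →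
        FramedRep.IsAbsolutelyIrreducible ρ) ∧
      κ₁.IsCyclotomic ∧ κ₂.IsAnticyclotomic ∧
      (∃ ζ : ℤ_[p]ˣ, IsOfFinOrder ζ ∧
        ((GaloisRep.cyclotomicCharacter K p γ₁ * ζ : ℤ_[p]ˣ) : ℤ_[p]) = (cyclotomicGenerator p : ℤ_[p]))

/-- **S1a + S1b ⇒ S1** (bookkeeping). -/
theorem definiteFieldSupply_of (ha : RamifiedLevelPrime) (hb : DefiniteFieldSupplyFrom) : DefiniteFieldSupply := by
  intro p _ W _ _ N hN h5 hX
  obtain ⟨q₀, hq₀, hqN, hCR⟩ := ha p W h5 hX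
  obtain ⟨K, iF, iNF, ι, v, vbar, κ₁, κ₂, γ₁, γ₂, iTG, iNZ, h⟩ := hb p W N hN h5 hX q₀ hq₀ hqN hCR
  exact ⟨K, iF, iNF, ι, v, vbar, κ₁, κ₂, γ₁, γ₂, iTG, iNZ, q₀, h⟩

/-- **The composition of line «defanchor», rev 4, PROVED — the SEVEN-stub form answering VERDICT #21 (P1):**
S1a (PUB: Ribet), S1b (elementary supply), S2, S3′, S4, S6 (held), S7 (`p = 3` residual) imply the crux BY NAME
(S5 proved, S3's `G ≠ 0` derived). Register either this (seven stubs, the PUB input visible) or `…₆'` (six). -/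
theorem kobayashiLowerHalfSemistable_of_defanchor₇ (h1a : RamifiedLevelPrime) (h1b : DefiniteFieldSupplyFrom)
    (h2 : DefinitePackage) (h3 : ES2DefiniteIncl) (h4 : DefiniteLineEisenstein) (h6 : NamedInputs)
    (h7 : ThreeResidual) :
    Summit.BirchSwinnertonDyer.BirchSwinnertonDyer.Theses.SignedLowerHalves.KobayashiLowerHalfSemistable :=
  kobayashiLowerHalfSemistable_of_defanchor₆' (definiteFieldSupply_of h1a h1b) h2 h3 h4 h6 h7



/-! ### §10 (rev 5) VARIANT «defmu» — the wall S4 AND the ES side S3′ REPLACED: GMC_r BY NAME (BSTW Thm 9.24, the tree's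
### OPEN binder `thm924_greenberg_dvd_charIdealXGr₂_awayFromCyc_OPEN`, whose hypothesis (spl) the DEFINITE datum MEETS — `q₀`
### inert) + the anticyclotomic `μ(𝓛^{∘,−}) = 0` (Vatsal 2003 / Pollack–Weston 2011 at a definite-CR `K`, PUB) + the tree's
### cancellation theorem `dvd_of_dvd_map_C_mul_of_hasUnitContent_minus` (kernel-proved Weierstrass division over `𝒪_{ℂ_p}⟦T₁⟧`)

THE MECHANISM (μ-transfer through the `ℤ_p²`-package). GMC_r gives a non-zero CYCLOTOMIC-variable `s(T₁)` with
`s · ch(X_Gr)^ur ⊆ (G)`; the package identity (P1) `(ξ_∘ G) = ch · (𝓛^∘)` turns it into `𝓛^∘ ∣ s(T₁) · ξ_∘` (cancel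
`G ≠ 0`, itself free from (P1), `ch ≠ ⊥`, `𝓛^∘ ≠ 0`); and `s(T₁)` is cancelled against the unit content of
`𝓛^∘(0, T₂)` — the ANTICYCLOTOMIC `μ`-invariant of the signed function, which at a definite-CR `K` is ZERO in print
(PW11 Thm 2.5: `μ(λ^±_f) = 0`, `μ(L^±_f) = ord_p(c_f/ξ_f)`; PW11 (1)/§6: `= Σ_{q ∣ N⁻} t_f(q) = ord_p c_{q₀}(E) = 0` on the
ramified branch `p ∤ v_{q₀}(Δ_W)`) — whereas the CYCLOTOMIC `μ` of `L_p^±(E)` (line `birth_musplit`'s `MuSplit`) is not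
known. Result: `𝓛^∘ ∣ ξ_∘` TWO-VARIABLY, with no Euler-system input over `K` and no Eisenstein-side stub; the descent
`definiteDescentDvd` (S5 with `∣` for `~`, PROVED) finishes with Kato over `ℚ`. At a Heegner `K` (route SignedBaseChange,
X7) GMC_r is unavailable ((spl) fails, `N` not square-free) and `μ(G⁻) = 0` is used instead (K2R‴ `stub_muZero`); at a
definite `K` `G⁻ ≡ 0` (sign −1 in the BDP range) and the roles swap: the SIGNED function carries the unit content.

FIVE hypotheses: S1aʳ `RamifiedLevelPrimeR` (PUB: Ribet), S1bʳ `DefiniteFieldSupplyFromR` (elementary + tower supply),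
Cμ `DefinitePackageMu` (PRE package ⊕ PUB `μ = 0` ⊕ the comparison `𝓛^∘(0,T₂) ≐ L^ε_{f,K}` up to `𝒪^×`),
`NamedInputs₂` (HELD: `NamedInputs ∧ GMC_r`), S7 `ThreeResidual`; composition `kobayashiLowerHalfSemistable_of_defmu` PROVED. -/

section DefMu

open Summit.BirchSwinnertonDyer.BirchSwinnertonDyer.Theorems.SignedBaseChangeK2RTransferDescent

/-- **S1aʳ `RamifiedLevelPrimeR` (PUB BY NAME — Ribet; rev 5 = S1a with the RAMIFIED branch only):** for `(W, p)` on X6 at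
`5 ≤ p` some prime `q₀ ∣ N_W` has `p ∤ v_{q₀}(Δ_W)` — `ρ̄_{E,p}` ramified at `q₀` (Tate; split or non-split
multiplicative alike) and `p ∤ c_{q₀}(E)` (`c_{q₀} = v_{q₀}(Δ)` or `∈ {1, 2}`). Why true: otherwise `ρ̄_{E,p}`
(irreducible, `ClassX6.irr`; finite flat at `p`) is unramified outside `p` of Serre type `(1, 2)`, so modular of level 1
and weight 2 (Ribet 1990 Thm 1.1 / Khare–Wintenberger), contradicting `S₂(SL₂(ℤ)) = 0`. Not yet a Literature fact.
Nothing asserted. [cite: Ribet1990, Thm. 1.1] [cite: KhareWintenberger2009, Thm. 1.2] -/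
def RamifiedLevelPrimeR : Prop :=
  ∀ (p : ℕ) [Fact p.Prime] (W : WeierstrassCurve ℚ) [W.IsElliptic] [W.IsGloballyMinimal],
    5 ≤ p → Rank1Residual.ClassX6 W p →
    ∃ q₀ : ℕ, q₀.Prime ∧ (q₀ : ℤ) ∣ W.conductorNorm ℤ ∧ ¬ ((p : ℤ) ∣ padicValRat q₀ W.Δ)

/-- **S1bʳ `DefiniteFieldSupplyFromR` (elementary + the `ℤ_p²`-tower supply; rev 5 = S1b with the ramified branch and the
extra clause «`2` splits in `K` or `2 ∣ N`» = (spl) of BSTW Thm 9.24):** given a prime `q₀ ∣ N_W` with `p ∤ v_{q₀}(Δ_W)`,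
an imaginary quadratic `K` with `p` split, `q₀` inert, every other `ℓ ∣ N` split, `2` split or `2 ∣ N`, `(N, D_K) = 1`,
`q₀ ∥ N`, `ρ̄|_{G_K}` absolutely irreducible, tower data with `γ₁` canonical, `ι` inducing `v`. (Dirichlet: `−D_K` a
prime in the residue classes «square mod every `ℓ ∣ pN`, `ℓ ≠ q₀`», «non-square mod `q₀`», «`≡ 7 (mod 8)`».)
Nothing asserted. [Dirichlet's theorem; CRT; Serre 1972 §5.4] -/
def DefiniteFieldSupplyFromR : Prop :=
  ∀ (p : ℕ) [Fact p.Prime] (W : WeierstrassCurve ℚ) [W.IsElliptic] [W.IsGloballyMinimal] (N : ℕ),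
    (N : ℤ) = W.conductorNorm ℤ → 5 ≤ p → Rank1Residual.ClassX6 W p →
    ∀ q₀ : ℕ, q₀.Prime → (q₀ : ℤ) ∣ W.conductorNorm ℤ →
      ¬ ((p : ℤ) ∣ padicValRat q₀ W.Δ) →
    ∃ (K : Type) (_ : Field K) (_ : NumberField K) (ι : PadicAlgCl p ≃+* ℂ)
      (v vbar : HeightOneSpectrum (𝓞 K)) (κ₁ κ₂ : ZpExtension K p) (γ₁ γ₂ : absoluteGaloisGroup K)
      (_ : Fact (ZpExtension.IsTopGeneratorPair κ₁ κ₂ γ₁ γ₂)) (_ : NeZero (NumberField.discr K).natAbs),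
      IsImaginaryQuadratic K ∧ ((Ideal.span {(p : ℤ)}).primesOver (𝓞 K)).ncard = 2 ∧
      ((p : ℕ) : 𝓞 K) ∈ v.asIdeal ∧ ((p : ℕ) : 𝓞 K) ∈ vbar.asIdeal ∧ vbar ≠ v ∧
      (∀ (w : InfinitePlace K) (k : 𝓞 K), k ∈ v.asIdeal ↔ ‖ι.symm (w.embedding (k : K))‖ < 1) ∧
      IsCoprime (N : ℤ) (NumberField.discr K) ∧
      q₀.Prime ∧ q₀ ∣ N ∧ ¬ (q₀ ^ 2 ∣ N) ∧
      ((Ideal.span {(q₀ : ℤ)}).primesOver (𝓞 K)).ncard = 1 ∧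
      (∀ ℓ : ℕ, ℓ.Prime → ℓ ∣ N → ℓ ≠ q₀ → ((Ideal.span {(ℓ : ℤ)}).primesOver (𝓞 K)).ncard = 2) ∧
      (((Ideal.span {(2 : ℤ)}).primesOver (𝓞 K)).ncard = 2 ∨ 2 ∣ N) ∧
      ¬ ((p : ℤ) ∣ padicValRat q₀ W.Δ) ∧
      (∀ ρ : ModPGaloisRep K (ZMod p) 2, (W.baseChange K).IsTorsionGaloisRep p ρ →
        FramedRep.IsAbsolutelyIrreducible ρ) ∧
      κ₁.IsCyclotomic ∧ κ₂.IsAnticyclotomic ∧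
      (∃ ζ : ℤ_[p]ˣ, IsOfFinOrder ζ ∧
        ((GaloisRep.cyclotomicCharacter K p γ₁ * ζ : ℤ_[p]ˣ) : ℤ_[p]) = (cyclotomicGenerator p : ℤ_[p]))

/-- **Cμ `DefinitePackageMu` (PRE package ⊕ PUB anticyclotomic `μ = 0`; rev 5, replaces S2 ∧ S3′ ∧ S4):** for every
definite-CR datum (rev-5 clauses), every frame, structure map and sign, the BSTW signed two-variable package
`(ξ_∘, 𝓛^∘)` with (P1)–(P3) exists WITH `𝓛^∘(0, T₂)` OF UNIT CONTENT (`μ = 0` on the anticyclotomic line). In print: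
the package is BSTW Props 1.18/2.7/5.19 (the tree's `props118_27_519_exists_signedTwoVariablePackage_supersingular_PRE`,
which carries NO Heegner hypothesis, instantiated at the definite `K`); the unit content is Vatsal 2003 Thm 1.1 /
Pollack–Weston 2011 Thm 2.5 (`μ(λ^ε_f) = 0`) with PW11 (1), §6 (`μ(L^ε_f) = Σ_{q∣N⁻} t_f(q) = ord_p c_{q₀} = 0` under CR on
the ramified branch), GRANTED the comparison `(𝓛^∘(0,T₂)) = (L^ε_{f,K})` in `𝒪_{ℂ_p}⟦T₂⟧` (same special values
`L(f,χ,1)`, `χ` anticyclotomic of finite order, Kobayashi condition `ε` at both `v`, `v̄`; canonical period) — the one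
comparison this stub adds to printed statements (BSTW (sspLac)-type; cf. K2R‴ `stub_muZero`, which needs the analogous
comparison `(G⁻) = (L^BDP)` at a Heegner `K`). The `μ`-clause sits INSIDE the `∃` on purpose: (P1)–(P3) do not pin
`𝓛^∘(0,T₂)` up to a unit (if `(ξ_∘) = (𝓛^∘)`, `(ξ_∘⁺, 𝓛^∘·ξ_∘⁺/ξ_∘)` with `ξ_∘⁺` read `T₂`-constant is another solution,
of anticyclotomic restriction `∝ ξ_∘(0,0)`, possibly `0`), so a `∀`-solutions `μ`-statement would be spuriously false.
Nothing asserted. [cite: BurungaleSkinnerTianWan2024, Props. 1.18, 2.7, 5.19] [cite: PollackWeston2011, Thm. 1.1,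
Thm. 2.5, (1)] [cite: Vatsal2003, Thm. 1.1] -/
def DefinitePackageMu : Prop :=
  ∀ {p : ℕ} [Fact p.Prime] (ι : PadicAlgCl p ≃+* ℂ) (W : WeierstrassCurve ℚ) [W.IsElliptic]
    [W.IsGloballyMinimal] (K : Type) [Field K] [NumberField K] (v vbar : HeightOneSpectrum (𝓞 K))
    (κ₁ κ₂ : ZpExtension K p) (γ₁ γ₂ : absoluteGaloisGroup K)
    [Fact (ZpExtension.IsTopGeneratorPair κ₁ κ₂ γ₁ γ₂)] {N : ℕ} [NeZero N] (f : CuspForm (Gamma0 N) 2)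
    [NeZero (NumberField.discr K).natAbs],
    IsNewformOf W f → (N : ℤ) = W.conductorNorm ℤ → p ≠ 2 → ¬ (p : ℤ) ∣ W.conductorNorm ℤ →
    W.frobeniusTrace p = 0 →
    IsImaginaryQuadratic K → ((Ideal.span {(p : ℤ)}).primesOver (𝓞 K)).ncard = 2 →
    ((p : ℕ) : 𝓞 K) ∈ v.asIdeal → ((p : ℕ) : 𝓞 K) ∈ vbar.asIdeal → vbar ≠ v →
    (∀ (w : InfinitePlace K) (k : 𝓞 K), k ∈ v.asIdeal ↔ ‖ι.symm (w.embedding (k : K))‖ < 1) →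
    IsCoprime (N : ℤ) (NumberField.discr K) →
    -- ⟨definite-CR datum, rev 5: X6 at 5 ≤ p; ONE prime q₀ ∥ N inert in K, every other ℓ ∣ N split; `2` split or
    --  `2 ∣ N` ((spl) of BSTW Thm 9.24); (CR, RAMIFIED branch only) `p ∤ v_{q₀}(Δ_W)` (ρ̄ ramified at q₀, `p ∤ c_{q₀}`)⟩
    5 ≤ p → Rank1Residual.ClassX6 W p →
    ∀ q₀ : ℕ, q₀.Prime → q₀ ∣ N → ¬ (q₀ ^ 2 ∣ N) →
      ((Ideal.span {(q₀ : ℤ)}).primesOver (𝓞 K)).ncard = 1 →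
      (∀ ℓ : ℕ, ℓ.Prime → ℓ ∣ N → ℓ ≠ q₀ → ((Ideal.span {(ℓ : ℤ)}).primesOver (𝓞 K)).ncard = 2) →
      (((Ideal.span {(2 : ℤ)}).primesOver (𝓞 K)).ncard = 2 ∨ 2 ∣ N) →
      ¬ ((p : ℤ) ∣ padicValRat q₀ W.Δ) →
    (∀ ρ : ModPGaloisRep K (ZMod p) 2, (W.baseChange K).IsTorsionGaloisRep p ρ →
      FramedRep.IsAbsolutelyIrreducible ρ) →
    κ₁.IsCyclotomic → κ₂.IsAnticyclotomic →
    ∀ (Ω δ : ℂ) (Ωp : (unrIntegers p)ˣ) (LK G : PowerSeries (PowerSeries (PadicComplexInt p))),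
      Ω ≠ 0 → (δ ^ 2 = (NumberField.discr K : ℂ) ∨ δ ^ 2 = -(NumberField.discr K : ℂ)) →
      IsKatzMeasure₂ ι v vbar ∅ κ₁ κ₂ γ₁⁻¹ γ₂⁻¹ 1 Ω δ ((Ωp : unrIntegers p) : PadicComplex p) LK →
      IsGreenbergLFunctionAnyRoot₂ ι v vbar κ₁ κ₂ γ₁⁻¹ γ₂⁻¹ f (NumberField.discr K).natAbs
        (NumberField.classNumber K) LK G →
    ∀ J : ℤ_[p] →+* PadicComplexInt p,
      (∀ x : ℤ_[p], ((J x : PadicComplexInt p) : PadicComplex p) = ((x : ℚ_[p]) : PadicComplex p)) →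
    ∀ ε : ℤˣ,
    ∃ xi Lsig : PowerSeries (PowerSeries (PadicComplexInt p)),
      GreenbergVatsal2000.HasUnitContent (UnrSeries₂.minus Lsig) ∧
      (Ideal.span {xi * G} =
          (WeierstrassCurve.XGr₂.charIdeal (W.baseChange K) p κ₁ κ₂ vbar γ₁ γ₂).map
              (IwasawaAlgebra₂.toUnr₂ p J) * Ideal.span {Lsig} ∧
      ∀ (κ : ZpExtension ℚ p) (γ : absoluteGaloisGroup ℚ), κ.IsCyclotomic → κ.IsTopGenerator γ →
        IsCyclotomicVariable p γ →
        (∃ ζ : ℤ_[p]ˣ, IsOfFinOrder ζ ∧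
          GaloisRep.cyclotomicCharacter ℚ p γ * ζ = GaloisRep.cyclotomicCharacter K p γ₁) →
        ∀ (W₂ : WeierstrassCurve ℚ) [W₂.IsElliptic] [W₂.IsGloballyMinimal]
          (C₂ : WeierstrassCurve.VariableChange ℚ),
          C₂ • W₂ = W.quadraticTwist (NumberField.discr K : ℚ) →
          (∀ (D₁ : Kobayashi2003.SignedSelmerDualData W κ γ ε)
              (D₂ : Kobayashi2003.SignedSelmerDualData W₂ κ γ ε) (g₁ g₂ : IwasawaAlgebra p),
              D₁.charIdeal = Ideal.span {g₁} → D₂.charIdeal = Ideal.span {g₂} →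
              UnrSeries₂.plus xi ∣ PowerSeries.map J (g₁ * g₂)) ∧
          (∀ {N₂ : ℕ} [NeZero N₂] (f₂ : CuspForm (Gamma0 N₂) 2), IsNewformOf W₂ f₂ →
            ∀ (L₁ L₂ : IwasawaAlgebra p), Kobayashi2003.IsSignedPAdicLFunction f p ε L₁ →
              Kobayashi2003.IsSignedPAdicLFunction f₂ p ε L₂ →
              ∃ u : PowerSeries (PadicComplexInt p), IsUnit u ∧
                UnrSeries₂.plus Lsig = u * PowerSeries.map J (L₁ * L₂)))

/-- **`NamedInputs₂` (HELD, cite-only, BY NAME; rev 5):** `NamedInputs` (BSTW Thm 6.17 frames PRE; Kobayashi Thms 1.2/4.1;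
modularity; period unit) ∧ GMC_r = BSTW Thm 9.24 first clause, the tree's OPEN binder (claim under review, GAP(G2);
consumed by name exactly as `Theorems/SignedBaseChangeK1Rung.twistPairProduct_of_thm924` does). Nothing asserted. -/
def NamedInputs₂ : Prop :=
  NamedInputs ∧ thm924_greenberg_dvd_charIdealXGr₂_awayFromCyc_OPEN

/-- **S5ʳ `DefiniteDescentDvd` (PROVED below — `definiteDescentDvd`):** `DefiniteDescent` with the two-variable
DIVISIBILITY `𝓛^∘ ∣ ξ_∘` in place of the association (the proof of `definiteDescent` used only this direction). -/
def DefiniteDescentDvd : Prop :=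
  Kobayashi2003.thm12_signedSelmerDual_finite_torsion → Kobayashi2003.thm41_signedCharIdeal_divisibility →
  nonempty_modularParametrizationData → realPeriodRat_eq_unit_mul_plusPeriod →
  ∀ {p : ℕ} [Fact p.Prime] (ι : PadicAlgCl p ≃+* ℂ) (W : WeierstrassCurve ℚ) [W.IsElliptic]
    [W.IsGloballyMinimal] (K : Type) [Field K] [NumberField K] (v vbar : HeightOneSpectrum (𝓞 K))
    (κ₁ κ₂ : ZpExtension K p) (γ₁ γ₂ : absoluteGaloisGroup K)
    [Fact (ZpExtension.IsTopGeneratorPair κ₁ κ₂ γ₁ γ₂)] {N : ℕ} [NeZero N] (f : CuspForm (Gamma0 N) 2)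
    [NeZero (NumberField.discr K).natAbs],
    IsNewformOf W f → (N : ℤ) = W.conductorNorm ℤ → p ≠ 2 → ¬ (p : ℤ) ∣ W.conductorNorm ℤ →
    W.frobeniusTrace p = 0 →
    IsImaginaryQuadratic K → ((Ideal.span {(p : ℤ)}).primesOver (𝓞 K)).ncard = 2 →
    ((p : ℕ) : 𝓞 K) ∈ v.asIdeal → ((p : ℕ) : 𝓞 K) ∈ vbar.asIdeal → vbar ≠ v →
    (∀ (w : InfinitePlace K) (k : 𝓞 K), k ∈ v.asIdeal ↔ ‖ι.symm (w.embedding (k : K))‖ < 1) →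
    IsCoprime (N : ℤ) (NumberField.discr K) →
    5 ≤ p → Rank1Residual.ClassX6 W p →
    (∀ ρ : ModPGaloisRep K (ZMod p) 2, (W.baseChange K).IsTorsionGaloisRep p ρ →
      FramedRep.IsAbsolutelyIrreducible ρ) →
    κ₁.IsCyclotomic → κ₂.IsAnticyclotomic →
    -- «γ₁ canonical»
    (∃ ζ : ℤ_[p]ˣ, IsOfFinOrder ζ ∧
      ((GaloisRep.cyclotomicCharacter K p γ₁ * ζ : ℤ_[p]ˣ) : ℤ_[p]) = (cyclotomicGenerator p : ℤ_[p])) →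
    ∀ (Ω δ : ℂ) (Ωp : (unrIntegers p)ˣ) (LK G : PowerSeries (PowerSeries (PadicComplexInt p))),
      Ω ≠ 0 → (δ ^ 2 = (NumberField.discr K : ℂ) ∨ δ ^ 2 = -(NumberField.discr K : ℂ)) →
      IsKatzMeasure₂ ι v vbar ∅ κ₁ κ₂ γ₁⁻¹ γ₂⁻¹ 1 Ω δ ((Ωp : unrIntegers p) : PadicComplex p) LK →
      IsGreenbergLFunctionAnyRoot₂ ι v vbar κ₁ κ₂ γ₁⁻¹ γ₂⁻¹ f (NumberField.discr K).natAbs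
        (NumberField.classNumber K) LK G →
    ∀ J : ℤ_[p] →+* PadicComplexInt p,
      (∀ x : ℤ_[p], ((J x : PadicComplexInt p) : PadicComplex p) = ((x : ℚ_[p]) : PadicComplex p)) →
    ∀ ε : ℤˣ,
    ∀ xi Lsig : PowerSeries (PowerSeries (PadicComplexInt p)),
      Lsig ∣ xi →
      (Ideal.span {xi * G} =
          (WeierstrassCurve.XGr₂.charIdeal (W.baseChange K) p κ₁ κ₂ vbar γ₁ γ₂).map
              (IwasawaAlgebra₂.toUnr₂ p J) * Ideal.span {Lsig} ∧
      ∀ (κ : ZpExtension ℚ p) (γ : absoluteGaloisGroup ℚ), κ.IsCyclotomic → κ.IsTopGenerator γ →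
        IsCyclotomicVariable p γ →
        (∃ ζ : ℤ_[p]ˣ, IsOfFinOrder ζ ∧
          GaloisRep.cyclotomicCharacter ℚ p γ * ζ = GaloisRep.cyclotomicCharacter K p γ₁) →
        ∀ (W₂ : WeierstrassCurve ℚ) [W₂.IsElliptic] [W₂.IsGloballyMinimal]
          (C₂ : WeierstrassCurve.VariableChange ℚ),
          C₂ • W₂ = W.quadraticTwist (NumberField.discr K : ℚ) →
          (∀ (D₁ : Kobayashi2003.SignedSelmerDualData W κ γ ε)
              (D₂ : Kobayashi2003.SignedSelmerDualData W₂ κ γ ε) (g₁ g₂ : IwasawaAlgebra p),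
              D₁.charIdeal = Ideal.span {g₁} → D₂.charIdeal = Ideal.span {g₂} →
              UnrSeries₂.plus xi ∣ PowerSeries.map J (g₁ * g₂)) ∧
          (∀ {N₂ : ℕ} [NeZero N₂] (f₂ : CuspForm (Gamma0 N₂) 2), IsNewformOf W₂ f₂ →
            ∀ (L₁ L₂ : IwasawaAlgebra p), Kobayashi2003.IsSignedPAdicLFunction f p ε L₁ →
              Kobayashi2003.IsSignedPAdicLFunction f₂ p ε L₂ →
              ∃ u : PowerSeries (PadicComplexInt p), IsUnit u ∧
                UnrSeries₂.plus Lsig = u * PowerSeries.map J (L₁ * L₂))) →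
      Summit.BirchSwinnertonDyer.Rank1Residual.Supersingular.KobayashiMainConjecture W p ε

/-- **The algebraic core of «defmu» (PROVED): GMC_r ⊕ (P1) ⊕ `μ(𝓛^∘(0,T₂)) = 0` ⊕ `G ≠ 0` ⇒ `𝓛^∘ ∣ ξ_∘` two-variably.**
From `s·ch ≤ (G)` and `(ξ G) = ch·(𝓛)`: `(s)(ξ G) ≤ (G 𝓛)`, i.e. `G 𝓛 ∣ s ξ G`; cancel `G`; then cancel the
cyclotomic-variable `s ≠ 0` against the unit content of `𝓛(0,T₂)` (`dvd_of_dvd_map_C_mul_of_hasUnitContent_minus`).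
[cite: BurungaleSkinnerTianWan2024, §2.3 proof of Thm. (KoMC'_lb), last paragraph (the `μ`-cancellation, there for `G⁻`)] -/
theorem dvd_of_awayFromCyc_of_package {p : ℕ} [Fact p.Prime]
    {xi Lsig G : PowerSeries (PowerSeries (PadicComplexInt p))} {ch : Ideal (PowerSeries (PowerSeries (PadicComplexInt p)))}
    {s : PowerSeries (PadicComplexInt p)} (hμ : GreenbergVatsal2000.HasUnitContent (UnrSeries₂.minus Lsig)) (hs : s ≠ 0)
    (h924 : Ideal.span {PowerSeries.map (PowerSeries.C (R := PadicComplexInt p)) s} * ch ≤ Ideal.span {G})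
    (hP1 : Ideal.span {xi * G} = ch * Ideal.span {Lsig}) (hG : G ≠ 0) : Lsig ∣ xi := by
  have hle : Ideal.span {PowerSeries.map (PowerSeries.C (R := PadicComplexInt p)) s} * Ideal.span {xi * G} ≤
      Ideal.span {G} * Ideal.span {Lsig} := by
    rw [hP1, ← mul_assoc]
    exact Ideal.mul_mono_left h924
  rw [Ideal.span_singleton_mul_span_singleton, Ideal.span_singleton_mul_span_singleton,
    Ideal.span_singleton_le_span_singleton] at hle
  obtain ⟨k, hk⟩ := hle
  have hk' : PowerSeries.map (PowerSeries.C (R := PadicComplexInt p)) s * xi = Lsig * k := by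
    apply mul_left_cancel₀ hG
    calc G * (PowerSeries.map (PowerSeries.C (R := PadicComplexInt p)) s * xi)
        = PowerSeries.map (PowerSeries.C (R := PadicComplexInt p)) s * (xi * G) := by ring
      _ = G * Lsig * k := hk
      _ = G * (Lsig * k) := by ring
  exact dvd_of_dvd_map_C_mul_of_hasUnitContent_minus hμ hs ⟨k, hk'⟩

/-- A series whose anticyclotomic restriction has unit content is non-zero (bookkeeping). -/
theorem ne_zero_of_hasUnitContent_minus {p : ℕ} [Fact p.Prime] {L : PowerSeries (PowerSeries (PadicComplexInt p))}
    (hμ : GreenbergVatsal2000.HasUnitContent (UnrSeries₂.minus L)) : L ≠ 0 := by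
  rintro rfl
  obtain ⟨n, hn⟩ := hμ
  simp [UnrSeries₂.minus] at hn

open scoped MatrixGroups ModularForm in
open WeierstrassCurve Literature.NumberTheory.EllipticCurves.Rank1Residual
  Literature.NumberTheory.EllipticCurves.BurungaleCastellaSkinner2025
  Literature.NumberTheory.EllipticCurves.Kobayashi2003 ZpExtension
  Summit.BirchSwinnertonDyer.Rank1Residual.Supersingular
  Summit.BirchSwinnertonDyer.BirchSwinnertonDyer.Theorems.SignedBaseChangeEisensteinSqueeze
  Summit.BirchSwinnertonDyer.BirchSwinnertonDyer.Theorems.SignedBaseChangeAuxiliaryCurves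
  Summit.BirchSwinnertonDyer.BirchSwinnertonDyer.Theorems.SignedBaseChangeK2RTransferDescent in
/-- **S5ʳ holds (PROVED)** — the proof of `definiteDescent` verbatim, starting from `𝓛^∘ ∣ ξ_∘` instead of the association.
[cite: BurungaleSkinnerTianWan2024, §2.3 proof of Thm. (KoMC_r)] [cite: Kobayashi2003, Thm. 1.2, Thm. 4.1 (p. 8)] -/
theorem definiteDescentDvd : DefiniteDescentDvd := by
  intro h12 h41 hmod h5 p _ ι W _ _ K _ _ v vbar κ₁ κ₂ γ₁ γ₂ _ N _ f _ hf hN hp2 hpN hap hK hsplit hv hvbar hvv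
    hι hcop hp5 hX hirr hκ₁ hκ₂ hcan Ω δ Ωp LK G hΩ hδ hLK hG J hJ ε xi Ls hdvd hpkg
  obtain ⟨hP1, hline⟩ := hpkg
  -- basics at `p` for `W` (X6 ⇒ good supersingular, `ρ̄` onto, `E[p]` irreducible)
  have hpP : p.Prime := Fact.out
  have hgood : W.HasGoodReductionAtPrime p := hX.1.1
  have hs : Surj W p := ClassX6.surj W p hp2 hX
  have hirrW : Irr W p := ClassX6.irr W p hp2 hX
  -- the auxiliary curve `W₂ ≃ W^{(D_K)}`: good at `p`, `a_p = 0`, `ρ̄` onto (`p ∤ D_K` as `p` splits)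
  have hpD : ¬ (p : ℤ) ∣ NumberField.discr K := not_dvd_discr_of_ncard_primesOver_eq_two hK.1 hpP hsplit
  have hD0 : (NumberField.discr K : ℚ) ≠ 0 := by exact_mod_cast NumberField.discr_ne_zero K
  obtain ⟨W₂, _, _, C₂, hC₂⟩ := exists_isGloballyMinimal_smul_eq_quadraticTwist W hD0
  obtain ⟨hgood₂, hap₂, hs₂⟩ :=
    goodSS_surj_of_smul_eq_quadraticTwist_discr hK.1 W W₂ p hp2 hpD hC₂ hgood hap hs
  -- levels = conductors: Kobayashi's conjecture binds the conductor-level newform, which is `f` (uniqueness)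
  have hNn : N = W.conductorNorm ℤ := by exact_mod_cast hN
  subst hNn
  intro κ γ hκ hγ hγ' _ fK hfK ϖ hϖ Lp Lm hPP D
  have hfeq : f = fK := hf.unique hfK
  subst hfeq
  -- Thm. 1.2 for `W`
  haveI hfin : Module.Finite (IwasawaAlgebra p) D.X := h12.moduleFinite hp2 hgood hap hκ hγ D
  have hXt : Module.IsTorsion (IwasawaAlgebra p) D.X := h12.isTorsion hp2 hgood hap hκ hγ D
  refine ⟨hXt, ?_⟩
  obtain ⟨g₁, hg₁⟩ := (charIdeal_isPrincipal_holds p D.X).principal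
  have hg₁' : D.charIdeal = Ideal.span {g₁} := hg₁
  -- auxiliary data for `W₂`: newform (modularity), Pollack pair, Selmer datum, generator
  haveI : NeZero (W₂.conductorNorm ℤ) := ⟨(W₂.conductorNorm_pos_holds).ne'⟩
  obtain ⟨Dm₂⟩ := hmod W₂
  obtain ⟨Lp₂, Lm₂, hPP₂⟩ :=
    exists_isPollackPair pollack_exists_plusMinusPAdicLFunction_holds hp2 Dm₂.isNewformOf hgood₂ hap₂
  obtain ⟨D₂⟩ := nonempty_signedSelmerDualData W₂ κ ε hγ
  obtain ⟨g₂, hg₂⟩ := (charIdeal_isPrincipal_holds p D₂.X).principal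
  have hg₂' : D₂.charIdeal = Ideal.span {g₂} := hg₂
  -- the cyclotomic-line clauses (P2), (P3) for `(W, W₂)` at the canonical `ℚ`-variable `γ`
  have hcoord := exists_isOfFinOrder_mul_eq_of_canonical hcan hγ'
  obtain ⟨hP2, hP3⟩ := hline κ γ hκ hγ hγ' hcoord W₂ C₂ hC₂
  have hL₁ := hPP.isSignedPAdicLFunction_kobayashiL ε
  have hL₂ := hPP₂.isSignedPAdicLFunction_kobayashiL ε
  have h2 := hP2 D D₂ g₁ g₂ hg₁' hg₂'
  obtain ⟨u, hu, h3⟩ := hP3 Dm₂.f Dm₂.isNewformOf _ _ hL₁ hL₂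
  -- from the two-variable divisibility `𝓛^∘ ∣ ξ_∘`: descend through `plus` with (P2), (P3)
  have hS : PowerSeries.map J (kobayashiL ε Lp Lm * kobayashiL ε Lp₂ Lm₂) * 1 ∣
      PowerSeries.map J (g₁ * g₂) * 1 :=
    mul_dvd_mul_of_map_of_dvd_of_eq_unit_mul
      (PowerSeries.map (PowerSeries.constantCoeff (R := PadicComplexInt p)))
      (ξ' := 1) (L' := 1) (a' := 1) (b' := 1) (u' := 1)
      (by simpa using hdvd) h2 (by simp) hu isUnit_one h3 (by simp)
  rw [mul_one, mul_one] at hS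
  -- descend to `ℤ_p⟦T⟧`
  have hZ : kobayashiL ε Lp Lm * kobayashiL ε Lp₂ Lm₂ ∣ g₁ * g₂ :=
    Summit.BirchSwinnertonDyer.BirchSwinnertonDyer.Theorems.SignedBaseChangeK2RDivisibilityDescent.iwasawaAlgebra_dvd_of_map_dvd_map_padicComplexInt
      hJ hS
  -- Kobayashi Thm. 4.1 (integral under `Surj`) for `W` and `W₂`
  have hL20 := Wuthrich2014.lemma20_surjective_threeAdic_of_semistable_holds
  have hK₁ : g₁ ∣ kobayashiL ε Lp Lm :=
    h41.dvd_of_charIdeal_eq_span hp2 hgood hap hfK hκ hγ hγ' hL₁ D hXt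
      (surjective_pow_of_surj_of_good W p hL20 hp2 hgood hs) hg₁'
  haveI : Module.Finite (IwasawaAlgebra p) D₂.X := h12.moduleFinite hp2 hgood₂ hap₂ hκ hγ D₂
  have hK₂ : g₂ ∣ kobayashiL ε Lp₂ Lm₂ :=
    h41.dvd_of_charIdeal_eq_span hp2 hgood₂ hap₂ Dm₂.isNewformOf hκ hγ hγ' hL₂ D₂
      (h12.isTorsion hp2 hgood₂ hap₂ hκ hγ D₂) (surjective_pow_of_surj_of_good W₂ p hL20 hp2 hgood₂ hs₂) hg₂'
  -- two-factor squeeze: `(g₁) = (L^ε(f))`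
  have hassoc₁ : Associated g₁ (kobayashiL ε Lp Lm) :=
    associated_of_dvd_of_mul4_dvd (g₃ := 1) (g₄ := 1) (L₃ := 1) (L₄ := 1) hK₁ hK₂ (dvd_refl 1) (dvd_refl 1)
      (kobayashiL_ne_zero hPP ε) (kobayashiL_ne_zero hPP₂ ε) one_ne_zero one_ne_zero (by simpa using hZ)
  have hchar : D.charIdeal = Ideal.span {kobayashiL ε Lp Lm} := by
    rw [hg₁']; exact Ideal.span_singleton_eq_span_singleton.mpr hassoc₁
  -- Néron normalisation: `ϖ` is a `p`-adic unit
  set L := kobayashiL ε Lp Lm with hL_def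
  have hvϖ : padicValRat p ϖ = 0 :=
    padicValRat_periodRatio_eq_zero_of_five_le h5 W p hp5 hgood hirrW _ hfK ϖ hϖ
  have hϖ0 : ϖ ≠ 0 := by
    intro hz
    rw [hz, Rat.cast_zero, zero_mul] at hϖ
    exact (IsNewform0.plusPeriod_pos_holds hfK.1 hfK.coeffField_eq_bot).ne' hϖ.symm
  obtain ⟨u₁, hu₁⟩ := exists_units_coe_eq_ratCast hϖ0 hvϖ
  obtain ⟨hspan', hι'⟩ := span_C_units_mul_eq u₁ L
  refine ⟨PowerSeries.C (u₁ : ℤ_[p]) * L, ?_, ?_⟩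
  · rw [hchar, hspan']
  · rw [hι', hu₁]

/-- **The `5 ≤ p` branch of «defmu» (PROVED):** S1aʳ + S1bʳ give the definite-CR datum; `NamedInputs₂` the frame, `J`
and GMC_r's cyclotomic witness `s` ((spl) ← `q₀` inert, «`2` split or `2 ∣ N`» ← the datum, `N` square-free ← X6
semistability via `semistable_iff_isSemistable_int` + `isSemistable_iff_squarefree_conductorNorm`); Cμ the package with
`μ(𝓛^∘(0,T₂)) = 0`; `dvd_of_awayFromCyc_of_package` gives `𝓛^∘ ∣ ξ_∘`; `definiteDescentDvd` gives Kobayashi's main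
conjecture for `(W, p, 1)`, whence the Eisenstein half. -/
theorem five_le_of_defmu (h1a : RamifiedLevelPrimeR) (h1b : DefiniteFieldSupplyFromR) (hC : DefinitePackageMu)
    (h6 : NamedInputs₂) (W : WeierstrassCurve ℚ) [W.IsElliptic] [W.IsGloballyMinimal] (p : ℕ) [Fact p.Prime]
    (hp : p ≠ 2) (hX : Rank1Residual.ClassX6 W p) (h5p : 5 ≤ p) :
    ∃ ε : ℤˣ, Summit.BirchSwinnertonDyer.Rank1Residual.Supersingular.KobayashiLowerDivisibility W p ε := by
  obtain ⟨⟨h617, h12, h41, hmod, hper⟩, h924⟩ := h6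
  haveI : NeZero (W.conductorNorm ℤ) := ⟨(W.conductorNorm_pos_holds).ne'⟩
  obtain ⟨π⟩ := hmod W
  -- the local facts at `p` read off the class, and square-freeness of `N_W` from semistability
  have hgood : W.HasGoodReductionAtPrime p := hX.1.1
  have hpN' : ¬ p ∣ W.conductorNorm ℤ := not_dvd_conductorNorm_of_hasGoodReductionAtPrime W hgood
  have hpN : ¬ (p : ℤ) ∣ W.conductorNorm ℤ := by exact_mod_cast hpN'
  have ha0 : W.frobeniusTrace p = 0 := (W.natCast_dvd_frobeniusTrace_iff_eq_zero p h5p hgood).mp hX.1.2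
  have hN : ((W.conductorNorm ℤ : ℕ) : ℤ) = W.conductorNorm ℤ := rfl
  have hsq : Squarefree (W.conductorNorm ℤ) :=
    (W.isSemistable_iff_squarefree_conductorNorm).mp ((Rank1Residual.semistable_iff_isSemistable_int W).mp hX.2.1)
  -- S1aʳ: the ramified level prime; S1bʳ: the definite datum with this `q₀` inert
  obtain ⟨q₀, hq₀, hqN, hCR⟩ := h1a p W h5p hX
  obtain ⟨K, _, _, ι, v, vbar, κ₁, κ₂, γ₁, γ₂, _, _, hIQ, hsp, hv, hvbar, hvv, hι, hcop, hq₀', hqN', hq2, hin, hspl,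
    h2K, hCR', hirr, hκ₁, hκ₂, hcan⟩ := h1b p W (W.conductorNorm ℤ) hN h5p hX q₀ hq₀ hqN hCR
  -- a Katz/Greenberg frame for `π.f` over `K`, and a structure map `J`
  obtain ⟨Ω, δ, Ωp, LK, G, hΩ, hδ, hLK, hGr⟩ :=
    h617 ι W K v vbar κ₁ κ₂ γ₁ γ₂ π.isNewformOf hN h5p hpN ha0 hIQ hsp hv hvbar hvv hι hcop hκ₁ hκ₂
  obtain ⟨J, hJ⟩ := exists_structureMap_padicInt (p := p)
  refine ⟨1, Summit.BirchSwinnertonDyer.Rank1Residual.Supersingular.kobayashiLowerDivisibility_of_mainConjecture ?_⟩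
  -- Cμ: the package with unit content on the anticyclotomic line, for `ε = 1`
  obtain ⟨xi, Lsig, hμ, hP1, hline⟩ := hC ι W K v vbar κ₁ κ₂ γ₁ γ₂ π.f π.isNewformOf hN hp hpN ha0 hIQ hsp hv hvbar
    hvv hι hcop h5p hX q₀ hq₀' hqN' hq2 hin hspl h2K hCR' hirr hκ₁ hκ₂ Ω δ Ωp LK G hΩ hδ hLK hGr J hJ 1
  -- GMC_r (BSTW Thm 9.24, BY NAME): the cyclotomic-variable witness `s`; (spl) from `q₀` inert
  obtain ⟨s, hs, hle⟩ := h924 ι W K v vbar κ₁ κ₂ γ₁ γ₂ π.isNewformOf hN hsq hp hpN' hIQ hsp hv hvbar hvv hι hcop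
    hirr ⟨q₀, hq₀', hqN', by rw [hin]; decide⟩ h2K hκ₁ hκ₂ Ω δ Ωp LK G hΩ hδ hLK hGr J hJ
  -- `G ≠ 0` is free: (P1), `ch ≠ ⊥`, `𝓛^∘ ≠ 0`
  have hLs : Lsig ≠ 0 := ne_zero_of_hasUnitContent_minus hμ
  have hG0 : G ≠ 0 :=
    ne_zero_of_span_mul_eq hP1 (map_charIdealXGr₂_ne_bot _ κ₁ κ₂ vbar γ₁ γ₂ (structureMap_injective hJ)) hLs
  -- the μ-transfer: `𝓛^∘ ∣ ξ_∘` two-variably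
  have hdvd : Lsig ∣ xi := dvd_of_awayFromCyc_of_package hμ hs hle hP1 hG0
  -- S5ʳ: descend and squeeze
  exact definiteDescentDvd h12 h41 hmod hper ι W K v vbar κ₁ κ₂ γ₁ γ₂ π.f π.isNewformOf hN hp hpN ha0 hIQ hsp hv
    hvbar hvv hι hcop h5p hX hirr hκ₁ hκ₂ hcan Ω δ Ωp LK G hΩ hδ hLK hGr J hJ 1 xi Lsig hdvd ⟨hP1, hline⟩

/-- **The composition of variant «defmu», rev 5, PROVED — FIVE hypotheses, NO Eisenstein-side and NO Euler-system stub:**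
S1aʳ (PUB: Ribet), S1bʳ (elementary + tower supply), Cμ (PRE package ⊕ PUB anticyclotomic `μ = 0` ⊕ one comparison),
`NamedInputs₂` (held: BSTW 6.17 PRE, BSTW 9.24 OPEN, Kobayashi, modularity, period unit), S7 (`p = 3` residual) imply the
crux BY NAME. Skeleton at adoption: `stub_s1a stub_s1b stub_pkgMu stub_named₂ stub_three` and `KobayashiLowerHalfSemistable_of
:= kobayashiLowerHalfSemistable_of_defmu …`. -/
theorem kobayashiLowerHalfSemistable_of_defmu (h1a : RamifiedLevelPrimeR) (h1b : DefiniteFieldSupplyFromR)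
    (hC : DefinitePackageMu) (h6 : NamedInputs₂) (h7 : ThreeResidual) :
    Summit.BirchSwinnertonDyer.BirchSwinnertonDyer.Theses.SignedLowerHalves.KobayashiLowerHalfSemistable := by
  intro W _ _ p hpF hp hX
  by_cases h : 5 ≤ p
  · exact five_le_of_defmu h1a h1b hC h6 W p hp hX h
  · have h2le := hpF.out.two_le
    have hlt : p < 5 := Nat.lt_of_not_le h
    interval_cases p
    · exact absurd rfl hp
    · exact h7 W hX
    · exact absurd hpF.out (by decide)

end DefMu

end Summit.BirchSwinnertonDyer.BirchSwinnertonDyer.Cruxes.KobayashiLowerHalfSemistable.DefanchorLine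

end
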